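import Summits.ABC.ABC.Theses.RibetTakahashiSplit
import Literature.NumberTheory.Automorphic.QuaternionAlgebraAdelic
import Literature.NumberTheory.Automorphic.BrandtXi
import Literature.NumberTheory.Automorphic.HyperbolicLaplaceSpectrum
import Literature.NumberTheory.Automorphic.ShimuraCurve
import Literature.NumberTheory.Automorphic.ShimuraCurveMapDegreeProofs
import Literature.NumberTheory.Automorphic.HypFundamentalDomainVolume
import Literature.NumberTheory.Automorphic.ShimuraCurveRibetTakahashiVolumeProofs
import Literature.NumberTheory.Automorphic.ShimuraCurveNormComparisonProofs
import Literature.NumberTheory.Automorphic.ShimuraCurveAnalyticProofs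
import Summits.ABC.ABC.Theorems.RibetTakahashiSplitManyPrimeValuationProductJLPackageLemmas
import Summits.ABC.ABC.Theorems.RibetTakahashiSplitManyPrimeValuationProductStubPeriodFormDegree
import Summits.ABC.ABC.Theorems.RibetTakahashiSplitManyPrimeValuationProductStubPeriodFormInvariance
import Summits.ABC.ABC.Theorems.RibetTakahashiSplitManyPrimeValuationProductLeverCalibration
import Summits.ABC.ABC.Theorems.RibetTakahashiSplitManyPrimeValuationProductJLDegreePackageOfRadius
import Summits.ABC.ABC.Theorems.RibetTakahashiSplitManyPrimeValuationProductShimuraDegreeLowerBoundOfPaired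
import Literature.NumberTheory.EllipticCurves.ModularCurve
import Literature.NumberTheory.EllipticCurves.GlobalMinimalModel
import Literature.NumberTheory.EllipticCurves.Szpiro
import Literature.NumberTheory.DiophantineGeometry.ConductorRadicalProofs
import Summits.ABC.ABC.Theorems.RibetTakahashiSplitManyPrimeValuationProductStubFermatInputKnownFrey

/-!
# Line `jl-zero-cycle-height` — skeleton for crux `RibetTakahashiSplit.ManyPrimeValuationProduct`
# (stmt-ABC-1561, route-ABC-RibetTakahashiSplit, rank 2)

See `Lines/jl-zero-cycle-height.md` (the line card) for the prose: idea, stubs, hardest stub,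
barriers, Disproof used, triage answers.

THE CRUX. `T(E) := ∏_{p ∥ N} ord_p(Δ_min) ≤ C_ε N^ε` for every `E/ℚ` semistable away from `2` with
`≥ 4` odd multiplicative primes.

THE LINE (card `Ideas/jl-zero-cycle-height.md`, 3 × pass). For an even set `D` of multiplicative
primes with co-level `M = N/∏D`, let `X = X_0^D(M) = Γ\ℍ` be the Shimura curve and `s` a weight-2
form on `X` whose periods lie in the Néron lattice `Λ_E` (= the pull-back `φ^*ω_E` of the Néron
differential under a parametrisation `φ : X → E`; Pasten's integral `f_{D,M}` is such a form up to
a bounded factor). Ribet–Takahashi–Pasten (arXiv:1705.09251 Thm 6.1(b), §16 (EqRTF)) + Frey–Zagier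
on both curves + `‖f_E‖² ≪ N log N` + `vol(X) = (π/3)φ(D)ψ(M)` give the PACKAGE INEQUALITY
  `log T_D ≤ C + ε log N + log vol(X) − log ∫_X ‖s‖²_pt dμ`            (`stub_jlPackage`, KNOWN),
and Jensen (`mean log ≤ log mean`, PROVED below) turns it into
  `log T_D ≤ C + ε log N − mean_X log ‖s‖²_pt`.
The hard core is the GEOMETRIC-MEAN LOWER BOUND `mean_X log ‖s‖²_pt ≥ −ε log N − C`
(`stub_zeroCycleHeight`, OPEN) — by the arithmetic adjunction formula `ω̂·d̂iv(s) = ω̂²` on a regular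
model this is VERBATIM the card's `ZeroCycleHeight : h_ω̂(Z(s)) + V(s) ≥ ω̂² − (ε/2)·d·log N` (the
zeros of the integral Jacquet–Langlands eigenform sit at the Jensen ceiling); it is stated here in
its complex-analytic dress, over the tree's Fuchsian/quaternionic vocabulary, so that it needs no
Arakelov theory to TYPE. Two arithmetic stubs close the skeleton honestly over the crux's FULL class:
the Diophantine input of Pasten's cokernel bound Thm 6.17 — "the multiplicative part of `Δ_min` is
not a perfect `ℓ`-th power, `ℓ ≥ 11`" — split into `stub_fermatInputKnown` (semistable `E`: Pasten
L.6.11, Mazur–Ribet–Wiles; Frey–Hellegouarch `E` and twists by `±1, ±2`: L.6.12, Wiles, Ribet,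
Darmon–Merel — KNOWN, and everything the route's Assembly feeds in) and `stub_fermatInputResidual`
(curves additive at `2` without a Frey model — OPEN, foreign: the only part of the class the JL
engine does not reach in print). The covering glue (`≤ 3` even co-level-`≥ 2` sets cover all
multiplicative primes; `T ≤ T_{D₁}T_{D₂}T_{D₃}`) and Jensen's inequality are PROVED here.

`ManyPrimeValuationProduct_of` composes the four registered stubs into the crux BY NAME
(kernel-checked; no `sorry` outside the four `stub_*`, which it invokes): Fermat input (known ∪
residual) + package + minimal lever ⟹ `PairedFactorisationBound`
(`pairedFactorisationBound_of_meanSquare`, rev c1; the rev-a3 route through the zero-cycle height is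
`pairedFactorisationBound_of` = package + Jensen + `ZeroCycleHeight`, kept PROVED with the height as a
hypothesis) ⟹ crux (`coveringGlue`); `pairedBoundTheta_of` is the kernel-checked θ-ladder
(`T_D ≤ C N^{θ+ε}` from the θ-weakened lever).

## Rev a1 (lead re-seat prover-line-stmt-ABC-1561-a1-0, 2026-08-16) — what changed
* Base = rev b2 of the previous lead b-0 (its wave 1: `stub_fermatInputKnown` closed modulo two
  FLT-calibre printed inputs, reduction landed p80751/p82851; `stub_fermatInputResidual` open, no
  witness below `N ≈ 1.25·10⁹`; `stub_jlPackage` typing faithful, blocked on the Shimura-curve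
  definition item + 8 printed facts; `stub_zeroCycleHeight` ⟺ crux_D ∧ reverse-Jensen defect).
* NEW registered stub `stub_defectBound : DefectBound` — the KILLABLE analytic half of the lever
  ("reverse-Jensen defect `Def(s) = log mean_F ‖s‖² − mean_F log ‖s‖² ≤ ε log N + C` for Néron-period
  forms"), registered as a disprover TARGET; it is not invoked by `ManyPrimeValuationProduct_of`
  (the composition still runs through the lever `stub_zeroCycleHeight`, the line's mechanism), but
  `zeroCycleHeight_of_paired_of_defect` (PROVED, b2) shows crux_D ∧ DefectBound ⟹ lever, so a kill of
  `stub_defectBound` kills the height route even where the crux is true.  The lead's split-side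
  falsifier (kit job of this seat: Def_N of the Néron-normalised newform on X_0(N), N prime ≤ 6·10⁴,
  with the exact identity mean_u log|f(u+iη)|² = −4πη + 4π Σ_{zeros ρ, Im ρ>η}(Im ρ − η)) reads on it.
* NEW calibration block "the minimal lever" (PROVED): `MeanSquareLowerBound` — "JL preserves integral
  size" verbatim, `log mean_F ‖s‖²_pt ≥ −(ε log N + C)` — with `meanSquareLowerBound_of_zeroCycleHeight`
  (Jensen), `pairedFactorisationBound_of_meanSquare` (package, no Jensen) and
  `meanSquareLowerBound_of_paired` (lower package + crux_D): modulo the two-sided package the minimal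
  lever is EXACTLY crux_D, and the registered lever = minimal lever + defect bound.  Any line through
  the Ribet–Takahashi–Pasten package must prove `MeanSquareLowerBound`; this one bets on doing it via
  heights of the zero cycle.
* The co-registered stubs of the dead line `unramified-window-census` are dropped (that line's death
  certificate is `Lines/unramified-window-census-dead.md`; its converses are landed).

## Rev a2 (lead a1, wave 1 integrated, 2026-08-16T08Z)
* W1 (`stub_fermatInputKnown`): the generalized-Fermat input is now NAMED in the tree —
  `Literature.NumberTheory.DiophantineGeometry.ribet1997_twoPowerFermat`,
  `…darmonMerel1997_denesEquation` (p88991 ACCEPTED) + Mathlib `FermatLastTheorem`; corollary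
  `fermatInputKnown_of_namedFacts` p88992 (pending build).  Here: `fermatInputKnown_of_inputs'`
  (PROVED from the landed `fermatInputKnown_of_mestreOesterle`, p82851): the stub is CLOSED MODULO
  the named facts `mestreOesterle1989_thm_1` + the three Fermat-type theorems; the registered
  unconditional `stub_fermatInputKnown` keeps its `sorry` (FLT technology is not in reach).
* W2 (`stub_fermatInputResidual`): worker verdict `stub-misstated` — every consumer of the crux in
  the route (Assembly/`closes`, glue A → `SubexpABCManyPrimes`, glue B → `AbcValuationProduct`)
  applies it ONLY to Frey-isomorphic curves (certified: `abc_of_manyPrimeFreyClass`,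
  `subexpABCManyPrimes_of_manyPrimeFreyClass`, `abcValuationProduct_of_manyPrimeFreyClass`, p88416
  ACCEPTED).  Here: `ManyPrimeValuationProductFrey` (the crux restricted to the Frey class, p88416's
  hypothesis verbatim), `manyPrimeFrey_of` (PROVED from stubs 3–4 + the two inputs of W1, WITHOUT
  `stub_fermatInputResidual`) and the line's standalone payoff `subexpABCManyPrimes_of_line`
  (sub-exponential abc in the many-prime regime, modulo package + lever + FLT-type named facts).
  Recommendation to the tenure planner (release note): re-cut r2 to the Frey (or semistable ∪ Frey)
  class; `stub_fermatInputResidual` is dead weight for the route (kept registered only because the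
  crux AS FILED ranges over the residual class).
* W3 (`stub_jlPackage`): Shimura-curve VOCABULARY LANDED — `Literature.NumberTheory.Automorphic.ShimuraCurve`
  (p87684 ACCEPTED: `ShimuraCurveData`, `normOneUnits`/`Gamma`, `peterssonNormSq`, `HasPeriodsIn`,
  `ShimuraParametrizationData`, …); named facts of the package in flight (worker resumed).  The
  posited `ShimuraSetup` of revs 0–a2 is REPLACED by it in rev a3 (statements unchanged verbatim).

## Rev c1 (continuation lead prover-line-stmt-ABC-1561-c1-0, 2026-08-16T17Z) — what changed
* THE REGISTERED HARD STUB IS NOW THE MINIMAL LEVER: `stub_meanSquareLowerBound : MeanSquareLowerBound`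
  ("Jacquet–Langlands preserves the size of integral newforms" verbatim:
  `log((vol F)⁻¹ ∫_F ‖s‖²_pt) ≥ −(ε log N + C)` for every admissible Néron-period form) replaces
  `stub_zeroCycleHeight` in `ManyPrimeValuationProduct_of` (via `pairedFactorisationBound_of_meanSquare`,
  the package consumed directly, no Jensen).  It is WEAKER than the rev-a3 lever by exactly
  `DefectBound` (`meanSquareLowerBound_of_zeroCycleHeight`, Jensen, PROVED) and crux_D-EQUIVALENT modulo
  the two-sided Ribet–Takahashi–Pasten package (`meanSquareLowerBound_of_paired`, PROVED; = the typed
  form `EigenformLowerBound 0` of the informal item stmt-ABC-1755, cf. its prover's certificate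
  p84836 `Theorems/RibetTakahashiSplitEigenformLowerBoundLadder.lean`).  `ZeroCycleHeight` (the line's
  mechanism: zeros of the JL eigenform at the Jensen ceiling) and `DefectBound` stay as definitions
  with their PROVED implications (`pairedFactorisationBound_of`, `zeroCycleHeight_of_paired_of_defect`);
  they are no longer registered `sorry`s — the composition needs less, and the one open analytic stub
  is exactly crux-sized (the honest shape for `promote-stub`).
* Frey-class corollaries re-targeted BY NAME at the route's re-cuts and freed of `hMO` (planner
  directions f0ad2644 / 5f4872ff / 9f89c74f): `manyPrimeFrey_of hFermat :
  RibetTakahashiSplit.ManyPrimeValuationProductFrey` (stmt-ABC-15149) and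
  `manyPrimeSemistableFrey_of hFermat : RibetTakahashiSplit.ManyPrimeValuationProductSemistableFrey`
  (stmt-ABC-15174, the route's staffed crux R2) from stubs 3–4 and the single cited generalized-Fermat
  input `hFermat` (Wiles + Ribet 1997 + Darmon–Merel = Pasten L.6.12), through the landed
  `exists_not_dvd_factorization_of_smul_eq_freyCurve` (p82851); the local copy of
  `ManyPrimeValuationProductFrey` and `subexpABCManyPrimes_of_line` are removed (the route decl
  `SubexpABCManyPrimes` was dropped by the gate's items-cap autofix 2026-08-16T14:16Z, so the import of
  `…FreyClassSuffices` is dropped too).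
* Stubs 1–3 unchanged and NOT re-staffed: 1 and 3 are closed modulo CITED theorems by design
  (p80751/p82851/p88991, JLPackagePrintedClass p87684+facts), 2 is an open generalized-Fermat statement
  on the residual class that no route glue consumes.
* Route note recorded with the item: S is a redundant hypothesis of `RibetTakahashiSplit.closes`
  (`manyPrimeValuationProduct_of_weightedSzpiroBound`, Bootstrap p81483: r3′ ⟹ S).

## Rev c2 (continuation lead prover-line-stmt-ABC-1561-c2-0, 2026-08-16T18Z) — what changed
* NEW registered stub 5 `stub_periodFormDegree : PeriodFormDegree` — the HYPOTHESIS-FREE RUNG of the lever,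
  PROVED and LANDED this cycle (p117508 ACCEPTED, `Theorems/RibetTakahashiSplitManyPrimeValuationProductStubPeriodFormDegree.lean`,
  397 lines, axioms propext/Classical.choice/Quot.sound): Frey's identity `∫_F ‖s‖²y² = d·covol(Λ_L)`, `d ≥ 1`,
  for EVERY non-zero period-lattice form on a compact Shimura curve and EVERY fundamental domain (the tree's
  new `ShimuraCurveData.exists_deg_of_hasPeriodsIn` + the area formula with multiplicity + `Λ`-tiling, run
  without uniformisation / Hecke condition / Weierstrass curve).  Not invoked by `ManyPrimeValuationProduct_of`
  (the composition is unchanged); it calibrates stub 4: `meanSquare_floor` (PROVED) gives, under the exact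
  quantifiers of `MeanSquareLowerBound`, the side conditions `IntegrableOn (pet s) F`, `0 < ∫_F pet s` for
  free and the floor `log mean_F ‖s‖² ≥ log covol(Λ_L) − log vol F`; `logValProd_le_of_package_of_floor`
  (PROVED) gives with the package `T_D ≤ e^C N^ε vol(X_0^D(M))/covol(Λ_E)` (Faltings-height rung).  The open
  content of stub 4 is therefore exactly the factor `vol·N^{−ε}/covol(Λ_E)` above the degree-one floor =
  a degree lower bound `deg(X_0^D(M) → E) ≥ vol(X)·N^{−ε}e^{−C}/covol(Λ_E)` for the Néron-period form.
* NEW registered stub 6 `stub_periodFormInvariance` (PROVED and LANDED, p117917 ACCEPTED,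
  `Theorems/…StubPeriodFormInvariance.lean`): `∫_F ‖s‖²y²` is the same for any two fundamental domains (same degree).
* Registered (stub-add) and LANDED in tree vocabulary (p117706 ACCEPTED,
  `Theorems/RibetTakahashiSplitManyPrimeValuationProductLeverCalibration.lean`): `manyPrimeValuationProduct_of_lever`
  (Fermat input on class → package → lever → crux; defeq-checked against `FermatInputOnClass → JLPackage →
  MeanSquareLowerBound → ManyPrimeValuationProduct`) and `meanSquareLowerBound_of_lowerPackage_of_paired`
  (lower package → paired crux → lever), so that the promote target (stub 4 = typed `EigenformLowerBound 0`,
  stmt-ABC-1755) and its crux-equivalence are importable from `Theorems/`.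
* ALL side conditions of the lever except `log`-integrability are now THEOREMS for admissible data:
  `volume_admissible_eq` (vol F = (π/3)φ(∏D)ψ(N/∏D): tree `volume_eq_volume_fd` + discharged Shimizu
  `volume_fd_eq_holds`), `volume_admissible_ne_zero/ne_top`, `ae_pos_pet` (isolated zeros), and
  `IntegrableOn (pet s) F`, `0 < ∫_F pet s` (stub 5).  Hence the CLEAN LEVER `MeanSquareLowerBoundClean`
  (only `s ≠ 0`, periods in `Λ_L`, `log`-integrability kept) with `meanSquareLowerBound_iff_clean` (PROVED),
  and the DEGREE FORM `NeronDegreeBound` with `meanSquareLowerBound_iff_neronDegreeBound` (PROVED):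
  the lever says exactly `log d(s) ≥ log vol(F) − log covol(Λ_E) − ε log N − C` for the degree `d(s) ≥ 1`
  of `Γ∖ℍ → ℂ/Λ_E` attached to every Néron-period form — the promote target in its final typed shape.
* Stubs 1–4 and `ManyPrimeValuationProduct_of` byte-identical to rev c1.

## Rev c3 (continuation lead prover-line-stmt-ABC-1561-c3-0, 2026-08-16T18Z) — what changed
* NEW registered stub 7 `stub_jlPackageAwayFromTwo` (this cycle's wave): the skeleton's `JLPackage` on the
  WHOLE class (semistable away from `2`, Fermat input as hypothesis) from Pasten's Thm 6.1 (b′) at `S = {2}`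
  (`PastenThm61bAwayFromTwo` — the literal specialisation of the conclusion of the tree's NEW theorem
  `Literature.NumberTheory.Automorphic.PastenShimura2024_thm_6_1_b'`, Pasten §6.6–6.9 performed in Lean in
  `ShimuraCurveRibetTakahashiCokernelProofs.lean`) and six cited theorems (Jacquet–Langlands existence, optimal
  `X₀(N)`-quotient, Cor 10.2 Manin bound at `S = {2}`, `‖f‖² ≪ N log N`, Faltings + Mazur–Kenku height comparison,
  Mazur–Kenku), the four meanwhile DISCHARGED package facts being used as theorems; bridge `jlPackage_of_facts`
  and the whole-class summary `pairedFactorisationBound_of_facts` (crux per covering set = cited theorems +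
  stub 2 + stub 4).  See the section "Rev c3" below.
* Stubs 1–6 and `ManyPrimeValuationProduct_of` byte-identical to rev c2; imports += `RationalIsogenyDegrees`,
  `ShimuraCurveMinimalDegreeIsogenyBoundProofs`.

## Rev c4 (continuation lead prover-line-stmt-ABC-1561-c4-0, 2026-08-16T19Z) — what changed
* (Planner direction rchoice 7ef2d121 / f0c4f122 on stmt-ABC-15193.) The package no longer consumes the XL-apex fact
  `abs_neronLatticeHeight_sub_le_of_isIsogenous` (h6) nor the raw Mazur–Kenku list `mazurKenku_exists_cyclic_isogeny` (h7):
  both enter ONLY through "two `ℚ`-isogenous elliptic curves over `ℚ` are joined by a `ℚ`-isogeny of degree `≤ 163`" =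
  the route item `RibetTakahashiSplit.MazurKenkuRadius` (stmt-ABC-15193), the finite half of Faltings' Lemma 5 being the
  PROVED `Literature.NumberTheory.EllipticCurves.integral_neronScaling_of_isGloballyMinimal_holds`.
* RESHAPE: the package is registered in DEGREE form `JLDegreePackage` — its witnesses EXPOSED (a global minimal model
  `C₀ • W`, a datum `X` of level `(∏D, N/∏D)`, a Hecke-equivariant `P : ShimuraParametrizationData X (C₀ • W)`), with
  `log T_D ≤ C + ε log N + log vol(X.fd) − (log P.deg + log covol Λ_P)` — and the registered HARD stub is the
  SHIMURA DEGREE LOWER BOUND `ShimuraDegreeLowerBound`: `log P.deg ≥ log vol(X.fd) − log covol(Λ_E) − ε log N − C` for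
  every globally minimal `E` semistable away from `2`, covering set `D`, admissible datum `X` and EVERY datum `P` of `E`
  on `X` — `δ_{D,M}(E)·covol(Λ_E) ≥ e^{−C} N^{−ε} vol(X_0^D(M))`, the quaternionic twin of Zagier + GHL on `X_0(N)`
  (`deg φ_N · covol(Λ_E) = 4π²c²(f,f) ≫ N^{1−ε}`).  It is WEAKER than the rev-c1 lever `MeanSquareLowerBound` (every
  Néron-period form; `shimuraDegreeLowerBound_of_meanSquareLowerBound`, PROVED via Frey's identity) and is EXACTLY what the
  package consumes (`pairedBoundFermat_of_degree`, PROVED).  `ManyPrimeValuationProduct_of` = coveringGlue ∘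
  `pairedFactorisationBound_of_degree` (Fermat input + degree package + degree lever).
* Registered stubs rev c4: `stub_fermatInputKnown`, `stub_fermatInputResidual` (unchanged), `stub_jlDegreePackage`
  (closed modulo five cited theorems + MazurKenkuRadius by stub 8), `stub_shimuraDegreeLowerBound` (THE LEVER, OPEN, lead),
  `stub_jlDegreePackageOfRadius` (stub 8, wave c4), `stub_shimuraDegreeLowerBoundOfPaired` (stub 9, wave c4: the CONVERSE
  "lever ⟸ crux_D" from cited theorems only — Pasten Thm 6.1 numerator `PastenShimura2024_thm_6_1`, GHL
  `murty_petersson_newform_lower_bound`, the optimal quotient, the radius — replacing rev a1's posited `JLLowerPackage`).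
  `stub_jlPackage : JLPackage` is now DERIVED (`jlPackage_of_degreePackage stub_jlDegreePackage`); `MeanSquareLowerBound`,
  `ZeroCycleHeight`, `DefectBound`, `JLLowerPackage` stay definitions with their proved relations; the sorried
  `stub_meanSquareLowerBound` is retired (its content is implied, not consumed).
* CALIBRATION LANDED p121801 (`Theorems/RibetTakahashiSplitManyPrimeValuationProductLeverCalibrationDegree.lean`, stub-add
  `manyPrimeValuationProduct_of_degreeLever`: Fermat input on class → `JLDegreePackage` → `ShimuraDegreeLowerBound` → crux in tree
  vocabulary, + `manyPrimeValuationProduct_of_routeFacts_of_degreeLever` via p121499) — the degree analogue of p117706.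
* WAVE c4 RESULT: stub 8 LANDED p121499 (`…JLDegreePackageOfRadius.lean`, 398 lines; helpers
  `ShimuraParametrizationData.deg_le_163_mul_deg_of_radius`, `…minimalDegree_le_163_mul_of_radius`), stub 9 LANDED p121504
  (`…ShimuraDegreeLowerBoundOfPaired.lean`; helper `gamma0Index_le_card_divisors_mul`). Both imported; sorries = stubs 1, 2, 3 (degree
  package, closed modulo cited theorems + MazurKenkuRadius by stub 8) and 4 (the lever). Hygiene per planner 119dc57d / a78bdf90:
  the rev-c3 decls `stub_jlPackageAwayFromTwo` / `jlPackage_of_facts` / `pairedFactorisationBound_of_facts` and their three imports are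
  dropped, so no declaration of the line types `abs_neronLatticeHeight_sub_le_of_isIsogenous` or `mazurKenku_exists_cyclic_isogeny`.

## Disproof used — rev c2 addendum (lead c2, read 2026-08-16T17Z: `Cruxes/ManyPrimeValuationProduct/Disproof.lean`
v6 + drefute g3 sections, and `Theorems/ManyPrimeValuationProduct/Negative/{JlScaling,DefectScaling,…}`): nothing in the
Targets section bears on stubs 5/6 (they are theorems); §2/§5 sandwich respected (no rung is claimed to reach the crux:
`logValProd_le_of_package_of_floor` is the Faltings-height rung, arithmetically weaker than the trivial `T_D ≤ d(Δ_min)`);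
`Negative/JlScaling` (integrality `HasPeriodsIn` load-bearing) is exactly what stub 5 quantifies: WITH periods in `Λ_L`
the floor is `covol(Λ_L)·d`, `d ≥ 1`; without it there is none.  The clean lever keeps `∀ ε ∃ C_ε` (§3/§4,
`Negative/ConstantBlowup`).

## Disproof used (cdisprove `Disproof.lean` v6 read 2026-08-16T06Z by lead a1: §7 Prasanna / Targets (census) add nothing for this line; v4, 2026-08-15T22:48Z, rc 0; known through its evidence
notes only — `run/gate/evidence/**` is not mounted on this hub and `Cruxes/…/Disproof.lean` is not
written; no `Theorems/ManyPrimeValuationProduct/Negative/` exists, checked 2026-08-16)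
* §3 `manyPrimeValuationProduct_false_without_epsilon` / `_false_uniform_constant`, §4
  `_false_polylog` (Frey family `W_{B,k}`: `T ≥ (2(k+1))^{ω(B)}`) — HONOURED: every statement here is
  `∀ ε > 0 ∃ C` with `C` depending on `ε` (`PairedFactorisationBound`, `JLPackage`,
  `ZeroCycleHeight(Theta)`); nothing ε-free or polylog is stated. The line USES ε at `stub_jlPackage`
  (`ω(N) log κ ≤ ε log N + C_ε`, `(f,f) ≪ N log N`, `log log N` losses) and at `stub_zeroCycleHeight`
  (the `ε d log N` slack below the Jensen ceiling; on `W_{B,k}` the zero cycle must sit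
  `≍ ω(B) log k` below the ceiling — allowed).
* §2 `manyPrime_of_abc` / §5 `manyPrime_of_quasiPolySzpiro` (crux ⟸ exp((log N)^{1+o(1)})-Szpiro) —
  consistent calibration: the line's output per covering set is `T_D ≤ C_ε N^ε`, no Szpiro-type
  statement is claimed or used.
* §6 `factorization_le_of_manyPrime` (crux ⇒ `v_p ≤ C_ε N^ε`) — consistent; not engaged.
* `ledger negatives --problem ABC` = stmt-ABC-1689 (GlobalQuasiLogDerivative), stmt-ABC-1205
  (BelyiSqueeze): unrelated; no stub is an instance of either.
-/

set_option linter.dupNamespace false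

noncomputable section

open MeasureTheory
open scoped MatrixGroups

namespace Summit.ABC.ABC.Cruxes.ManyPrimeValuationProduct.JlZeroCycleHeight

open Literature.NumberTheory.Automorphic
open Literature.NumberTheory.EllipticCurves.ModularForms (IsNeronLatticeOf)
open Literature.NumberTheory.EllipticCurves (freyCurve)
open Summit.ABC.ABC.Theses.RibetTakahashiSplit (ManyPrimeValuationProduct)

/-! ## Arithmetic vocabulary (the crux's own: conductor, minimal discriminant, valuations) -/

/-- The multiplicative primes of `W`: prime factors `p` of the conductor `N` with `p² ∤ N`
(exactly the index set of the crux's product `T(E)`; contains `2` iff `2 ∥ N`). -/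
def multPrimes (W : WeierstrassCurve ℚ) : Finset ℕ :=
  (W.conductorNorm ℤ).primeFactors.filter (fun p => ¬ p ^ 2 ∣ W.conductorNorm ℤ)

/-- `T_D(E) = ∏_{p ∈ D} ord_p(Δ_min(E))`, the valuation product over a set of primes `D`. -/
def valProd (W : WeierstrassCurve ℚ) (D : Finset ℕ) : ℕ :=
  ∏ p ∈ D, (W.minimalDiscriminantNorm ℤ).factorization p

/-- Semistable away from `2`: `p² ∤ N` for every odd prime `p` (the crux's standing hypothesis). -/
def IsSemistableAwayFromTwo (W : WeierstrassCurve ℚ) : Prop :=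
  ∀ p : ℕ, p.Prime → p ≠ 2 → ¬ p ^ 2 ∣ W.conductorNorm ℤ

/-- A COVERING SET of the line: an even set `D` of `≥ 2` multiplicative primes whose complement
in the multiplicative primes still has `≥ 2` elements — so the co-level `M = N/∏D` is divisible by
two multiplicative primes: Pasten's hypothesis (b.1) (`M` not prime) for semistable `E`, (b.2)
(`M` divisible by two odd primes) for Frey–Hellegouarch `E`, and the hypothesis of his Lemma 6.16
in general (triage r1-1/r1-3 sharpening (a): admissibility INSIDE the bound). -/
def IsCoveringSet (W : WeierstrassCurve ℚ) (D : Finset ℕ) : Prop :=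
  D ⊆ multPrimes W ∧ Even D.card ∧ 2 ≤ D.card ∧ 2 ≤ (multPrimes W \ D).card

/-- The level pair of a covering set: `D' = ∏_{p ∈ D} p` (squarefree, even `ω`) and `M = N/D'`. -/
def discOf (D : Finset ℕ) : ℕ := ∏ p ∈ D, p

/-- **FERMAT INPUT** at a curve (the Diophantine heart of Pasten's Thm 6.17 / Thm 6.1(b)): for every
prime `ℓ ≥ 11` some multiplicative prime `r` has `ℓ ∤ ord_r(Δ_min)`, i.e. the multiplicative part of
the minimal discriminant is not a perfect `ℓ`-th power. -/
def FermatInput (W : WeierstrassCurve ℚ) : Prop :=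
  ∀ ℓ : ℕ, ℓ.Prime → 11 ≤ ℓ → ∃ r ∈ multPrimes W, ¬ ℓ ∣ (W.minimalDiscriminantNorm ℤ).factorization r

/-- Semistable: `p² ∤ N` for every prime `p` (`2` included). -/
def IsSemistable (W : WeierstrassCurve ℚ) : Prop :=
  ∀ p : ℕ, p.Prime → ¬ p ^ 2 ∣ W.conductorNorm ℤ

/-- `W` is `ℚ`-isomorphic to a Frey–Hellegouarch curve `y² = x(x − da)(x + db)` with `a, b` coprime,
`ab(a+b) ≠ 0`, `d ∣ 2` (the tree's `freyCurve`, twisted by `d ∈ {±1, ±2}`): within the curves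
semistable away from `2` these are exactly the curves with full rational `2`-torsion. -/
def IsFreyIsomorphic (W : WeierstrassCurve ℚ) : Prop :=
  ∃ (a b d : ℤ) (C : WeierstrassCurve.VariableChange ℚ),
    IsCoprime a b ∧ a * b * (a + b) ≠ 0 ∧ d ∣ 2 ∧ C • W = freyCurve (d * a) (d * b)

/-- **Statement of stub 1 — the Fermat input where it is KNOWN**: semistable curves (Pasten L.6.11:
`Δ_E` is not a perfect `ℓ`-th power, `ℓ ≥ 11` — Mazur, Ribet's level lowering, Wiles) and
Frey–Hellegouarch curves and their twists by `±1, ±2` (L.6.12: the odd part of `Δ_E = 2^s(abc)²` is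
not an `ℓ`-th power, `ℓ ≥ 3` — Wiles, Ribet, Darmon–Merel). In print; formalisation debt = FLT
technology (lands as a named Literature fact, after which this stub is one line).
WAVE 1 (second lead): the FLT-free reduction is LANDED (p80751 `…StubFermatInputKnown.lean`, p82851
`…StubFermatInputKnownFrey.lean`; registered sub-goals `fermatInput_of_semistable_of_powExclusion`,
`fermatInputKnown_of_inputs` proved); the stub = `fermatInputKnown_of_inputs h611 hF` with
`h611 := Literature.NumberTheory.EllipticCurves.mestreOesterle1989_thm_1`-strength power exclusion
(in tree, unproved) and `hF :=` "`x^ℓ + 2^m y^ℓ + z^ℓ = 0 ⇒ |xyz| ≤ 1`, prime `ℓ ≥ 5`" (Cohen GTM 240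
Thm 15.3.1 = Wiles + Ribet 1997 + Darmon–Merel; not in tree) — certificate StubFermatInputKnownCert.lean. -/
def FermatInputKnown : Prop :=
  ∀ (W : WeierstrassCurve ℚ) [W.IsElliptic], IsSemistableAwayFromTwo W →
    4 ≤ (multPrimes W).card → (IsSemistable W ∨ IsFreyIsomorphic W) → FermatInput W

/-- **Statement of stub 2 — the Fermat input on the RESIDUAL class** (additive at `2`, no
Frey–Hellegouarch model; OPEN, foreign to the JL lever): the only curves of the crux's class that
Pasten's Thm 6.1(b) does not reach in print. A generalized-Fermat statement: such a curve with all
multiplicative exponents `≡ 0 (ℓ)` solves `±1728·2^s x^ℓ = c₄³ − c₆²` (Pasten L.6.10 settles each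
FIXED `ℓ` up to finitely many curves via Darmon–Granville; uniformity in `ℓ` is the open part, of
Frey–Mazur flavour: level-lowering lands on forms of level `2^t ≤ 256` instead of the empty
`S₂(Γ₀(2))`).
WAVE 1 (second lead, worker evidence ANALYSIS.md #32 / SCAN.md #33 on stmt-ABC-1561): KNOWN for
`ord₂ N ≤ 4` (level-lowering lands in `S₂(Γ₀(16)) = 0`); the OPEN remainder is exactly the absence of
mod-`ℓ` congruences, `ℓ ≥ 11`, between residual-class curves and (i) the newforms `128a–d` (every
`ℓ ≥ 11`, Frey–Mazur strength, finitely many per `ℓ`), (ii) the CM newforms of level `32/64/256` with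
`ℓ` inert in `ℚ(i)`/`ℚ(√−2)` (non-split Cartan case), (iii) the `ℓ = 13` rational-isogeny mode; any
counterexample has `N ≥ 1 248 255 616` (level-raising congruences `a_r(g) ≡ ±(r+1)`). -/
def FermatInputResidual : Prop :=
  ∀ (W : WeierstrassCurve ℚ) [W.IsElliptic], IsSemistableAwayFromTwo W →
    4 ≤ (multPrimes W).card → ¬ IsSemistable W → ¬ IsFreyIsomorphic W → FermatInput W

/-- The Fermat input on the whole class (from the two halves, by excluded middle). -/
def FermatInputOnClass : Prop :=
  ∀ (W : WeierstrassCurve ℚ) [W.IsElliptic], IsSemistableAwayFromTwo W →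
    4 ≤ (multPrimes W).card → FermatInput W

theorem fermatInputOnClass_of (hK : FermatInputKnown) (hR : FermatInputResidual) :
    FermatInputOnClass := by
  intro W _ hss h4
  by_cases h : IsSemistable W ∨ IsFreyIsomorphic W
  · exact hK W hss h4 h
  · simp only [not_or] at h
    exact hR W hss h4 h.1 h.2

/-- **The per-factorisation bound** (exponent `0`, typed arithmetic shadow of "JL preserves
integral size" on ONE Shimura curve; the card's `FactorisationBound 0` with admissibility moved
inside, as all three triagers asked): `T_D(E) ≤ C_ε N^ε` for every covering set `D`. -/
def PairedFactorisationBound : Prop :=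
  ∀ ε : ℝ, 0 < ε → ∃ C : ℝ, ∀ (W : WeierstrassCurve ℚ) [W.IsElliptic],
    IsSemistableAwayFromTwo W → ∀ D : Finset ℕ, IsCoveringSet W D →
      (valProd W D : ℝ) ≤ C * (W.conductorNorm ℤ : ℝ) ^ ε

/-- **The covering glue** (PROVED below, `coveringGlue`): the per-factorisation bound implies the
crux (with `≥ 4` odd multiplicative primes every multiplicative prime, `2` included when `2 ∥ N`,
lies in one of `≤ 3` covering sets, and `T ≤ T_{D₁} T_{D₂} T_{D₃}` because every factor is `≥ 1`). -/
def CoveringGlue : Prop :=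
  PairedFactorisationBound → ManyPrimeValuationProduct

/-! ## Shimura-curve vocabulary — the tree's (rev a3)

Rev a3: the posited interface of revs 0–a2 (`ShimuraSetup`, `Gamma`, `segmentIntegral`,
`HasPeriodsIn`) is REPLACED by the landed Literature vocabulary
`Literature.NumberTheory.Automorphic.ShimuraCurve` (p87684, wave 1 of this lead): `ShimuraCurveData D M`
(quaternion algebra ramified exactly at the primes of the squarefree `D`, Eichler order of level `M`,
injective real splitting, a fundamental domain), `ShimuraCurveData.Gamma = ι(O¹) = Γ₀^D(M)`,
`segmentIntegral`, `HasPeriodsIn` — same definitions verbatim, so every statement below is unchanged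
up to the name of the structure (which has one EXTRA field, the fundamental domain `fd`, not used by the
statements: they keep quantifying over every a.e. fundamental domain `F`). The pointwise Petersson
norm `pet` stays local (the Literature file has the set-integral `peterssonNormSq F h = ∫_F pet`). -/

/-- Pointwise Petersson norm `‖s‖²_pt(z) = |s(z)|² (Im z)²` of a weight-2 form (a `Γ`-invariant
function for `Γ` of determinant one); `peterssonNormSq F s = ∫_F pet s`. -/
def pet {Γ : Subgroup (GL (Fin 2) ℝ)} (s : CuspForm Γ 2) (z : UpperHalfPlane) : ℝ :=
  ‖s z‖ ^ 2 * z.im ^ 2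

/-- `L` is a NÉRON period pair of the elliptic curve `W/ℚ`: the period pair of the invariant
differential of some GLOBALLY MINIMAL model `C • W` (tree: `IsGloballyMinimal`, `IsNeronLatticeOf`);
its lattice `L.lattice = Λ_E ⊆ ℂ` is the Néron lattice (independent of the choices up to sign). -/
def IsNeronPeriodPairOf (W : WeierstrassCurve ℚ) (L : PeriodPair) : Prop :=
  ∃ C : WeierstrassCurve.VariableChange ℚ,
    (C • W).IsGloballyMinimal ∧ IsNeronLatticeOf ((C • W).baseChange ℂ) L

/-- **Statement of stub 3 — the Jacquet–Langlands / Ribet–Takahashi / Pasten PACKAGE** (known in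
print, given the Fermat input as hypothesis). For every `ε > 0` there is `C` such that for every
elliptic `W/ℚ` semistable away from `2` satisfying the Fermat input and every covering set `D`
(`D' = ∏D`, `M = N/D'`) there exist: a Néron period pair `L` of `W`; a Shimura curve datum `S` (tree `ShimuraCurveData`) of level
`(D', M)`; a measurable fundamental domain `F` of `Γ = S.Gamma` of finite positive hyperbolic area;
and a NON-ZERO weight-2 form `s` on `Γ` with periods in the Néron lattice, square-integrable with
integrable `log ‖s‖²_pt` on `F` and `‖s‖_pt > 0` a.e., such that
`log T_D ≤ C + ε log N + log vol(F) − log ∫_F ‖s‖²_pt dμ`.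
In print this is: `X_0^{D'}(M)` parametrises `E` (BCDT + Jacquet–Langlands + Faltings); Pasten
Thm 6.1(b) `log T_D ≤ log δ_{1,N} − log δ_{D',M} + O(ω(D'))`, whose proof (§6: Prop 6.13 =
Ribet–Takahashi, L.6.14–6.16, Thm 6.17, L.6.8) uses semistability / the Frey shape ONLY through
L.6.11/L.6.12 = `FermatInput W`, and L.6.16 through "`M` has two multiplicative primes" = the
covering condition; Cor DegApproxQ `δ_{D',M} ≤ deg φ_{D',M} ≤ (9 log N)² δ_{D',M}`; the Frey–Zagier
identities (EqFreyClassical)/(EqFreyQuaternionic) `log deg = 2 log ‖·‖₂ + 2h(A)` on both curves and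
`|h(A_{1,N}) − h(A_{D',M})| ≤ ½ log 163`; the Manin-constant bound Cor ManinCt (Česnavičius);
`‖f_E‖₂² ≪ N log N` (Mai–Murty; Hoffstein–Lockhart); the volume `vol(X_0^{D'}(M)) = (π/3)φ(D')ψ(M)
≥ N^{1−ε}/C`; `ω(N) ≪ log N / log log N`; and `s :=` the pull-back of `ω_E` under
`X_0^{D'}(M) → A_{D',M} → E` (an integer multiple, `|·| ≤ 163`, of Pasten's integral `f_{D',M}`).
WAVE 1 AUDIT (second lead, worker evidence REPORT.md on stmt-ABC-1561): typing FAITHFUL (cusp condition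
of `CuspForm S.Gamma 2` vacuous because `B` is division; `HasPeriodsIn` = pull-backs along
`Hom(J_ℂ, E_ℂ)`, a discrete group; `volume` = `dx dy/y²`; signs right; Cor DegApproxQ not needed over
`ℂ`). PROVENANCE: Thm 6.1(b) is PRINTED only for semistable (b.1) / Frey–Hellegouarch (b.2) curves;
on the rest of the class the inequality is Pasten's PROOF of Thm 6.17 run with `S = {2}` and the
Fermat input as hypothesis ("Thm 6.1(b′)", to be vendored in that form). BLOCKED on the definition
item `defn-ShimuraCurveIntegralForms` (p44732 bounced `revise`; file absent) + 8 named facts (REPORT §2.2). -/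
def JLPackage : Prop :=
  ∀ ε : ℝ, 0 < ε → ∃ C : ℝ, ∀ (W : WeierstrassCurve ℚ) [W.IsElliptic],
    IsSemistableAwayFromTwo W → FermatInput W → ∀ D : Finset ℕ, IsCoveringSet W D →
      ∃ (L : PeriodPair) (S : ShimuraCurveData (discOf D) (W.conductorNorm ℤ / discOf D))
        (F : Set UpperHalfPlane) (s : CuspForm S.Gamma 2),
        IsNeronPeriodPairOf W L ∧ IsHypFundamentalDomain S.Gamma F ∧ volume F ≠ 0 ∧ volume F ≠ ⊤ ∧
        s ≠ 0 ∧ HasPeriodsIn S.Gamma s (L.lattice : Set ℂ) ∧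
        IntegrableOn (pet s) F ∧ IntegrableOn (fun z => Real.log (pet s z)) F ∧
        (∀ᵐ z ∂(volume.restrict F), 0 < pet s z) ∧ (0 < ∫ z in F, pet s z) ∧
        Real.log (valProd W D) ≤ C + ε * Real.log (W.conductorNorm ℤ) +
          Real.log (volume F).toReal - Real.log (∫ z in F, pet s z)

/-- **Statement of stub 4 — ZERO-CYCLE HEIGHT, analytic dress (the hard core; OPEN).** For every
`ε > 0` there is `C` such that for every elliptic `W/ℚ` semistable away from `2`, every covering set
`D`, every Néron period pair `L`, EVERY Shimura curve datum `S` of level `(∏D, N/∏D)`, every fundamental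
domain `F` of finite positive area and every non-zero weight-2 form `s` on `S.Gamma` with periods in
the Néron lattice (and `log ‖s‖²_pt` integrable on `F`):
  `mean_F log ‖s‖²_pt ≥ −(ε log N + C)`.
Equivalently (adjunction formula on a regular model of `X_0^D(M)`, `c₁(ω̂) = (d/vol)·μ`):
`h_ω̂(Z(s)) + V(s) ≥ ω̂² − (d/2)(ε log N + C)` — the zero cycle of the Néron-period form sits at the
Jensen ceiling. By the package + Jensen it IMPLIES `T_D ≤ C' N^{2ε}`; conversely it is the crux for
`D` PLUS "reverse-Jensen defect `≤ ε log N`" (triage doubt 1, declared): strictly stronger than the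
crux by a Planck-scale flatness statement for quaternionic eigenforms.
RESHAPE b1 (second lead, 2026-08-16): the hypotheses `IntegrableOn (pet s) F`, `pet s > 0` a.e. on `F`
and `0 < ∫_F pet s` are ADDED (the package supplies them; they hold for every non-zero `s`, but are
not worth proving inside the lever) — the stub is weaker, the composition unchanged, and the
calibration `zeroCycleHeight_of_paired_of_defect` below becomes statable. -/
def ZeroCycleHeight : Prop :=
  ∀ ε : ℝ, 0 < ε → ∃ C : ℝ, ∀ (W : WeierstrassCurve ℚ) [W.IsElliptic],
    IsSemistableAwayFromTwo W → ∀ D : Finset ℕ, IsCoveringSet W D →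
    ∀ (L : PeriodPair), IsNeronPeriodPairOf W L →
    ∀ (S : ShimuraCurveData (discOf D) (W.conductorNorm ℤ / discOf D)) (F : Set UpperHalfPlane),
      IsHypFundamentalDomain S.Gamma F → volume F ≠ 0 → volume F ≠ ⊤ →
    ∀ (s : CuspForm S.Gamma 2), s ≠ 0 → HasPeriodsIn S.Gamma s (L.lattice : Set ℂ) →
      IntegrableOn (fun z => Real.log (pet s z)) F → IntegrableOn (pet s) F →
      (∀ᵐ z ∂(volume.restrict F), 0 < pet s z) → (0 < ∫ z in F, pet s z) →
        -(ε * Real.log (W.conductorNorm ℤ) + C) ≤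
          (volume F).toReal⁻¹ * ∫ z in F, Real.log (pet s z)

/-- **The θ-ladder** (route header: `EigenLowerBound(θ)`; card: `FactorisationLadder`): the zero-cycle
height weakened by `θ log N` — `mean_F log ‖s‖²_pt ≥ −((θ + ε) log N + C)`. `θ = 0` is the lever;
`θ = ω̂²/(d log N)` (`h_ω̂ ≥ 0` for algebraic points, `V ≥ 0`: the hypothesis-free Jensen rung) and
the Zhang-floor / point-floor values of `JensenDefectIdeator2.md` §2 are the rungs in reach, each
giving `T_D ≤ C N^{θ+ε}` per covering set (`pairedBoundTheta_of`) to compare with Pasten's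
`N^{8/3+ε} M` (Thm 16.4). -/
def ZeroCycleHeightTheta (θ : ℝ) : Prop :=
  ∀ ε : ℝ, 0 < ε → ∃ C : ℝ, ∀ (W : WeierstrassCurve ℚ) [W.IsElliptic],
    IsSemistableAwayFromTwo W → ∀ D : Finset ℕ, IsCoveringSet W D →
    ∀ (L : PeriodPair), IsNeronPeriodPairOf W L →
    ∀ (S : ShimuraCurveData (discOf D) (W.conductorNorm ℤ / discOf D)) (F : Set UpperHalfPlane),
      IsHypFundamentalDomain S.Gamma F → volume F ≠ 0 → volume F ≠ ⊤ →
    ∀ (s : CuspForm S.Gamma 2), s ≠ 0 → HasPeriodsIn S.Gamma s (L.lattice : Set ℂ) →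
      IntegrableOn (fun z => Real.log (pet s z)) F → IntegrableOn (pet s) F →
      (∀ᵐ z ∂(volume.restrict F), 0 < pet s z) → (0 < ∫ z in F, pet s z) →
        -((θ + ε) * Real.log (W.conductorNorm ℤ) + C) ≤
          (volume F).toReal⁻¹ * ∫ z in F, Real.log (pet s z)

/-- The lever is the bottom rung of the ladder. -/
theorem zeroCycleHeightTheta_zero_iff : ZeroCycleHeightTheta 0 ↔ ZeroCycleHeight := by
  simp only [ZeroCycleHeightTheta, ZeroCycleHeight, zero_add]

/-- **Statement of stub 4 (rev c1) — THE MINIMAL LEVER, "Jacquet–Langlands preserves the size of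
integral newforms"** (route thesis R2 in analytic dress; = `EigenformLowerBound 0` of the informal
item stmt-ABC-1755, typed over the landed `ShimuraCurveData` vocabulary): for every `ε > 0` there is
`C` such that for every elliptic `W/ℚ` semistable away from `2`, every covering set `D`, every Néron
period pair `L` of `W`, every Shimura curve datum `S` of level `(∏D, N/∏D)`, every fundamental domain
`F` of finite positive area and every non-zero weight-2 form `s` on `S.Gamma` with periods in the
Néron lattice (with the integrability / a.e.-positivity side conditions the package supplies), the
MEAN SQUARE of `s` is `≥ N^{−ε}/e^{C}`:
  `log((vol F)⁻¹ ∫_F ‖s‖²_pt) ≥ −(ε log N + C)`.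
It is what the package consumes (`pairedFactorisationBound_of_meanSquare`, no Jensen); it follows
from the zero-cycle height `ZeroCycleHeight` by Jensen (`meanSquareLowerBound_of_zeroCycleHeight`);
and modulo the LOWER half of the package it follows from the paired crux
(`meanSquareLowerBound_of_paired`) — so, modulo the two-sided Ribet–Takahashi–Pasten package,
minimal lever ⟺ crux_D: any non-circular proof must bound the mean square of the integrally
normalised JL eigenform from below WITHOUT passing through `T_D` (OPEN; Conj. 1.14-strength,
Disproof §2/§5). -/
def MeanSquareLowerBound : Prop :=
  ∀ ε : ℝ, 0 < ε → ∃ C : ℝ, ∀ (W : WeierstrassCurve ℚ) [W.IsElliptic],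
    IsSemistableAwayFromTwo W → ∀ D : Finset ℕ, IsCoveringSet W D →
    ∀ (L : PeriodPair), IsNeronPeriodPairOf W L →
    ∀ (S : ShimuraCurveData (discOf D) (W.conductorNorm ℤ / discOf D)) (F : Set UpperHalfPlane),
      IsHypFundamentalDomain S.Gamma F → volume F ≠ 0 → volume F ≠ ⊤ →
    ∀ (s : CuspForm S.Gamma 2), s ≠ 0 → HasPeriodsIn S.Gamma s (L.lattice : Set ℂ) →
      IntegrableOn (fun z => Real.log (pet s z)) F → IntegrableOn (pet s) F →
      (∀ᵐ z ∂(volume.restrict F), 0 < pet s z) → (0 < ∫ z in F, pet s z) →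
        -(ε * Real.log (W.conductorNorm ℤ) + C) ≤
          Real.log ((volume F).toReal⁻¹ * ∫ z in F, pet s z)

/-! ## Rev c4 vocabulary: the package in DEGREE form and the lever as a SHIMURA DEGREE LOWER BOUND -/

/-- **The package in DEGREE form** (rev c4; registered `stub_jlDegreePackage`, closed modulo five cited theorems +
`MazurKenkuRadius` by stub 8 `stub_jlDegreePackageOfRadius`). For every `ε > 0` there is `C` such that for every
elliptic `W/ℚ` semistable away from `2` satisfying the Fermat input and every covering set `D` there are: a global
minimal model `C₀ • W`; a Shimura-curve datum `X` of level `(∏D, N/∏D)`; and a parametrisation datum `P` of `C₀ • W`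
on `X` (tree `ShimuraParametrizationData`: periods in the Néron lattice `Λ_P = Λ_E`, Hecke-equivariant, `P.deg ≥ 1`)
with `log T_D ≤ C + ε log N + log vol(X.fd) − (log P.deg + log covol Λ_P)`.  This is `JLPackage` with its witnesses
exposed and Frey's identity `∫_{X.fd} ‖P.form‖²y² = P.deg · covol Λ_P` (discharged tree fact) already applied
(`jlPackage_of_degreePackage`, PROVED). -/
def JLDegreePackage : Prop :=
  ∀ ε : ℝ, 0 < ε → ∃ C : ℝ, ∀ (W : WeierstrassCurve ℚ) [W.IsElliptic],
    IsSemistableAwayFromTwo W → FermatInput W → ∀ D : Finset ℕ, IsCoveringSet W D →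
      ∃ C₀ : WeierstrassCurve.VariableChange ℚ, (C₀ • W).IsGloballyMinimal ∧
        ∃ (X : ShimuraCurveData (discOf D) (W.conductorNorm ℤ / discOf D))
          (P : ShimuraParametrizationData X (C₀ • W)),
          Real.log (valProd W D) ≤ C + ε * Real.log (W.conductorNorm ℤ) +
            Real.log (volume X.fd).toReal -
              (Real.log (P.deg : ℝ) + Real.log (ZLattice.covolume P.L.lattice))

/-- **THE LEVER, rev c4 — SHIMURA DEGREE LOWER BOUND** (registered hard stub `stub_shimuraDegreeLowerBound`; OPEN,
Conj. 1.14-strength, the lead holds it).  For every `ε > 0` there is `C` such that for every GLOBALLY MINIMAL elliptic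
`W/ℚ` semistable away from `2`, every covering set `D` (so `N = (∏D)·M` is admissible), every Shimura-curve datum `X`
of level `(∏D, M)` and EVERY parametrisation datum `P` of `W` on `X`:
  `log P.deg ≥ log vol(X.fd) − log covol(Λ_P) − ε log N − C`,
i.e. `δ_{D,M}(E) · covol(Λ_E) ≥ e^{−C} N^{−ε} · vol(X_0^D(M))` (`Λ_P = Λ_E` the Néron lattice, `vol = (π/3)φ(∏D)ψ(M)`).
WHY THIS FORM. (i) It is exactly what the package consumes (`pairedBoundFermat_of_degree`): with
`log T_D ≤ C + ε log N + log vol − log P.deg − log covol` it gives `log T_D ≤ C' + 2ε log N`. (ii) It is the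
QUATERNIONIC TWIN of a theorem: on `X_0(N)` (`D = 1`) Zagier's identity `deg φ_N · covol(Λ_E) = 4π² c² (f,f)` (PROVED,
`zagier_degree_formula_holds`, `c ∈ ℤ∖{0}`) and GHL `(f,f) ≫ N^{1−ε}` (`murty_petersson_newform_lower_bound`) give
`deg φ_N · covol(Λ_E) ≫ N^{1−ε} ≍ vol(X_0(N)) N^{−2ε}`; the lever asks the same of the Néron-normalised Jacquet–Langlands
transfer on `X_0^D(M)`, `D > 1` — "JL preserves the size of integral newforms" in degree clothing.  (iii) It is WEAKER
than the rev-c1 lever `MeanSquareLowerBound` (which quantified over EVERY Néron-period form `s`, Hecke or not):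
`shimuraDegreeLowerBound_of_meanSquareLowerBound` (PROVED, Frey's identity `‖P.form‖² = P.deg · covol`), respecting
`Negative/JlScaling` + `Negative/DefectScaling` (only the Hecke/JL direction carries content).  (iv) Modulo CITED theorems it
is EQUIVALENT to the paired crux: ⟸ by stub 9 `stub_shimuraDegreeLowerBoundOfPaired` (Thm 6.1 numerator, GHL, optimal
quotient, radius — wave c4), ⟹ by the package (stub 8) given the Fermat input.  Why it might fail / why plausibly true: as
for `MeanSquareLowerBound` (route header; Disproof §2: only `¬ABC` refutes it). -/
def ShimuraDegreeLowerBound : Prop :=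
  ∀ ε : ℝ, 0 < ε → ∃ C : ℝ, ∀ (W : WeierstrassCurve ℚ) [W.IsElliptic] [W.IsGloballyMinimal],
    IsSemistableAwayFromTwo W → ∀ D : Finset ℕ, IsCoveringSet W D →
    ∀ M : ℕ, discOf D * M = W.conductorNorm ℤ →
    ∀ (X : ShimuraCurveData (discOf D) M) (P : ShimuraParametrizationData X W),
      Real.log (volume X.fd).toReal - Real.log (ZLattice.covolume P.L.lattice) -
        (ε * Real.log (W.conductorNorm ℤ) + C) ≤ Real.log (P.deg : ℝ)

/-! ## The registered stubs (rev c4: 1, 2 unchanged; 3 → `stub_jlDegreePackage`; 4 → `stub_shimuraDegreeLowerBound`;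
8, 9 = wave c4) -/


/-- **Stub 1 — the Fermat input where it is known** (`FermatInputKnown`; L to formalise, KNOWN in
print: Pasten arXiv:1705.09251 L.6.11 (semistable) and L.6.12 (Frey–Hellegouarch; the argument is
verbatim for the twists by `±1, ±2`, which have the same odd discriminant part `(abc)²_odd`)). Why
it might fail: it does not at truth level. Size: L (named fact + transport along `C • W`). -/
theorem stub_fermatInputKnown : FermatInputKnown := by
  sorry

/-- **Stub 2 — the Fermat input on the residual class** (`FermatInputResidual`; L, OPEN, FOREIGN to
the JL lever — recorded so that the composition is honest about the crux's full class; the route's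
Assembly only feeds Frey–Hellegouarch curves, covered by stub 1). Why it might fail: a family of
curves additive at `2`, congruent mod large `ℓ` to a level-`2^t` newform, with every multiplicative
exponent `≡ 0 (ℓ)` (none known; each such curve is a rational point on a twist of `X(ℓ)` of genus
`≥ 3`). Size: L. -/
theorem stub_fermatInputResidual : FermatInputResidual := by
  sorry

/-- **Stub 3 (rev c4) — the JL / Ribet–Takahashi / Pasten package in DEGREE form** (`JLDegreePackage`; KNOWN in print,
closed modulo five cited theorems + the route item `MazurKenkuRadius` by stub 8 `stub_jlDegreePackageOfRadius`; see the
statement's docstring and `JLPackage`'s for the chain of cited results). Why it might fail: it does not at truth level;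
formalisation debt = Jacquet–Langlands existence, Pasten Thm 6.1 (b′)'s geometric inputs (Néron component groups of
`J_0^D(M)`), the optimal quotient (modularity + Edixhoven), Cor 10.2 (Manin at `S = {2}`), `‖f‖² ≪ N log N` (the tree
proves it for `2⁸ ∤ N`), Mazur–Kenku (radius). Size: XL as a programme; this stub = the repackaging (stub 8, M). -/
theorem stub_jlDegreePackage : JLDegreePackage := by
  sorry

/-- **Stub 4 (rev c4) — THE LEVER: the Shimura degree lower bound** (`ShimuraDegreeLowerBound`; XL, OPEN — HARDEST,
CRUX-SIZED; the lead holds this one).  `δ_{D,M}(E)·covol(Λ_E) ≥ e^{−C_ε} N^{−ε} vol(X_0^D(M))` for every globally minimal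
`E` semistable away from `2`, covering set `D` and datum `P` (the statement's docstring).  Why plausibly true: it is the
`D > 1` twin of Zagier + GHL on `X_0(N)`; the JL transfer with INTEGRAL (Néron) periods is believed to lose only `N^{o(1)}`
(Prasanna's integrality of `⟨f,f⟩/⟨g,g⟩` is the exact `p`-adic shadow); modulo cited theorems it is EQUIVALENT to the paired
crux (stubs 8/9), hence implied by `ABC` (Disproof §2).  Why it might fail: the Kodaira–Spencer / integral-structure defect
of the `p`-new JL eigenform may cost `≍ log p` per prime of `DM` even on Galois average, leaving `δ_{D,M} covol ≈ vol·N^{−c}`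
and `T_D` up to `N^{c}` (route header); at truth level only `¬ABC` refutes it.  Size: XL (Conj. 1.14-strength; the
informal item stmt-ABC-1755 `EigenformLowerBound` at `θ = 0` in degree form).  The rev-c1 lever `MeanSquareLowerBound`
(every Néron-period form) and the rev-a3 lever `ZeroCycleHeight` (= that ∧ `DefectBound` modulo the package) are kept below
as definitions with their proved implications; neither is a registered `sorry` any more. -/
theorem stub_shimuraDegreeLowerBound : ShimuraDegreeLowerBound := by
  sorry

/-- **Stub 8 (rev c4, wave c4) — the degree package on the WHOLE class from five cited theorems and the Mazur–Kenku
RADIUS — PROVED and LANDED** (p121499 ACCEPTED, commit 2e5048c458c7: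
`Summit.ABC.ABC.Theorems.ManyPrimeValuationProduct.stub_jlDegreePackageOfRadius`,
`Theorems/RibetTakahashiSplitManyPrimeValuationProductJLDegreePackageOfRadius.lean`, 398 lines, axioms propext/Classical.choice/Quot.sound;
registered signature, tree vocabulary, abbreviations unfolded; imported, no `sorry`).
Hypotheses, in order: Jacquet–Langlands existence (`nonempty_shimuraParametrizationData`); Pasten's Thm 6.1 (b′) at
`S = {2}` (`PastenThm61bAwayFromTwo` written out = the conclusion shape of the tree theorem `PastenShimura2024_thm_6_1_b'`);
the optimal `X₀(N)`-quotient (`exists_optimal_modularParametrizationData`); Cor 10.2 = Manin at `S = {2}`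
(`PastenShimura2024_cor_10_2`); `‖f‖² ≪ N log N` (`murty_petersson_newform_upper_bound`); and the ROUTE ITEM
`RibetTakahashiSplit.MazurKenkuRadius` (stmt-ABC-15193) — replacing h6 `abs_neronLatticeHeight_sub_le_of_isIsogenous` and h7
`mazurKenku_exists_cyclic_isogeny` of stub 7 (planner re-route 7ef2d121 / f0c4f122), the finite half of Faltings' Lemma 5
being the PROVED `integral_neronScaling_of_isGloballyMinimal_holds` (used as a theorem, like the four discharged package
facts `nonempty_shimuraCurveData_holds`, `volume_fd_eq_holds`, `normSq_form_eq_deg_mul_covolume_holds`,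
`shimuraCurve_pet_pos_ae_and_log_integrable_holds`).  Proof = stub 7's (Pasten §16, proof of Thm 16.4) with
`hdeg : P'.deg ≤ 163·δ_{D,M}` from the radius (re-proof of the tree's `deg_le_163_mul_deg_of_isIsogenous` with the
Mazur–Kenku list weakened to the radius) and `hVV : covol Λ_E ≤ 163 covol Λ_{A}` from the radius +
`covolume_le_degree_mul_covolume_of_integral_neronScaling`, the witnesses `C₀, X, P'` returned instead of `(L, S, F, s)`. -/
theorem stub_jlDegreePackageOfRadius :
    Literature.NumberTheory.Automorphic.nonempty_shimuraParametrizationData →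
    (∃ κ : ℕ, 1 ≤ κ ∧ (∀ q ∈ κ.primeFactors, q ≤ 163) ∧
      ∀ {N D M : ℕ} [NeZero N], Literature.NumberTheory.Automorphic.IsAdmissibleFactorization N D M →
      ∀ (X : Literature.NumberTheory.Automorphic.ShimuraCurveData D M) (W : WeierstrassCurve ℚ)
        [W.IsElliptic] [W.IsGloballyMinimal],
        W.conductorNorm ℤ = N → (∀ q : ℕ, q.Prime → q ∉ ({2} : Finset ℕ) → ¬ q ^ 2 ∣ N) →
        (∀ ℓ : ℕ, ℓ.Prime → 11 ≤ ℓ → ∃ r : ℕ, r.Prime ∧ r ∣ N ∧ ¬ r ^ 2 ∣ N ∧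
          ¬ ℓ ∣ (W.minimalDiscriminantNorm ℤ).factorization r) →
        (M.primeFactors.filter fun t => ¬ t ^ 2 ∣ N).card ≠ 1 →
      ∀ (W₁ : WeierstrassCurve ℚ) [W₁.IsElliptic]
        (D₁ : Literature.NumberTheory.EllipticCurves.ModularForms.ModularParametrizationData W₁ N),
        Literature.NumberTheory.EllipticCurves.ModularForms.IsNewformOf W D₁.f →
        (∀ (W₂ : WeierstrassCurve ℚ) [W₂.IsElliptic]
            (D₂ : Literature.NumberTheory.EllipticCurves.ModularForms.ModularParametrizationData W₂ N),
            D₂.f = D₁.f → D₁.modularDegree ≤ D₂.modularDegree) →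
      ∀ (W' : WeierstrassCurve ℚ) [W'.IsElliptic]
        (P : Literature.NumberTheory.Automorphic.ShimuraParametrizationData X W'),
        P.IsMinimalFor W →
          ∃ a b : ℕ, 0 < a ∧ 0 < b ∧ b ∣ κ ^ D.primeFactors.card ∧
            D₁.modularDegree * b =
              a * P.deg * ∏ p ∈ D.primeFactors, (W.minimalDiscriminantNorm ℤ).factorization p) →
    Literature.NumberTheory.Automorphic.exists_optimal_modularParametrizationData →
    Literature.NumberTheory.Automorphic.PastenShimura2024_cor_10_2 →
    Literature.NumberTheory.Automorphic.murty_petersson_newform_upper_bound →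
    Summit.ABC.ABC.Theses.RibetTakahashiSplit.MazurKenkuRadius →
    ∀ ε : ℝ, 0 < ε → ∃ C : ℝ, ∀ (W : WeierstrassCurve ℚ) [W.IsElliptic],
      (∀ p : ℕ, p.Prime → p ≠ 2 → ¬ p ^ 2 ∣ W.conductorNorm ℤ) →
      (∀ ℓ : ℕ, ℓ.Prime → 11 ≤ ℓ →
        ∃ r ∈ (W.conductorNorm ℤ).primeFactors.filter (fun p => ¬ p ^ 2 ∣ W.conductorNorm ℤ),
          ¬ ℓ ∣ (W.minimalDiscriminantNorm ℤ).factorization r) →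
      ∀ D : Finset ℕ,
        (D ⊆ (W.conductorNorm ℤ).primeFactors.filter (fun p => ¬ p ^ 2 ∣ W.conductorNorm ℤ) ∧
          Even D.card ∧ 2 ≤ D.card ∧
          2 ≤ ((W.conductorNorm ℤ).primeFactors.filter (fun p => ¬ p ^ 2 ∣ W.conductorNorm ℤ) \
            D).card) →
        ∃ C₀ : WeierstrassCurve.VariableChange ℚ, (C₀ • W).IsGloballyMinimal ∧
          ∃ (X : Literature.NumberTheory.Automorphic.ShimuraCurveData (∏ p ∈ D, p)
              (W.conductorNorm ℤ / ∏ p ∈ D, p))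
            (P : Literature.NumberTheory.Automorphic.ShimuraParametrizationData X (C₀ • W)),
            Real.log ((∏ p ∈ D, (W.minimalDiscriminantNorm ℤ).factorization p : ℕ) : ℝ) ≤
              C + ε * Real.log (W.conductorNorm ℤ) +
                Real.log (MeasureTheory.volume X.fd).toReal -
                  (Real.log (P.deg : ℝ) + Real.log (ZLattice.covolume P.L.lattice)) :=
  Summit.ABC.ABC.Theorems.ManyPrimeValuationProduct.stub_jlDegreePackageOfRadius

/-- **Stub 9 (rev c4, wave c4) — the CONVERSE: the lever from the paired crux, modulo cited theorems only — PROVED and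
LANDED** (p121504 ACCEPTED, commit 7e18245f5230:
`Summit.ABC.ABC.Theorems.ManyPrimeValuationProduct.stub_shimuraDegreeLowerBoundOfPaired`,
`Theorems/RibetTakahashiSplitManyPrimeValuationProductShimuraDegreeLowerBoundOfPaired.lean`, axioms propext/Classical.choice/Quot.sound;
registered signature, tree vocabulary, abbreviations unfolded; imported, no `sorry`).
Hypotheses, in order: Pasten's Thm 6.1 NUMERATOR statement (`PastenShimura2024_thm_6_1`: `δ_{1,N}·b = a·δ_{D,M}·T_D` with
`a ≤ 163^{ω(D)}`, for EVERY admissible `N = DM`, no hypothesis on `E`; unconditional in print), the optimal `X₀(N)`-quotient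
(`exists_optimal_modularParametrizationData`), GHL `(f,f) ≥ c_ε N^{1−ε}` (`murty_petersson_newform_lower_bound`), the route
item `MazurKenkuRadius`, and the PAIRED CRUX (`PairedFactorisationBound` written out: `T_D ≤ C_ε N^ε` for every curve
semistable away from `2` and every covering set).  Conclusion: `ShimuraDegreeLowerBound` written out.  Chain (for a globally
minimal `W`, covering set `D`, `N = D'M`, datum `X`, datum `P`): `P.deg ≥ P₀.deg` for a class-minimal `P₀`
(`exists_class_minimal`); Thm 6.1 numerator: `P₀.deg · T_D · a = δ_{1,N} · b ≥ δ_{1,N}`, `a ≤ 163^{ω}`; Zagier (PROVED):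
`δ_{1,N} · covol(Λ_{A}) = 4π² c² (f,f)`, `c² ≥ 1` (`maninConstant_ne_zero_holds`); radius + integral Néron scaling
(`covolume_le_degree_mul_covolume_of_integral_neronScaling'`): `covol(Λ_A) ≤ 163 covol(Λ_E)`; GHL: `(f,f) ≥ c_η N^{1−η}`;
crux_D: `T_D ≤ C_η N^η`; `163^ω ≤ d(D')^8 ≤ (C_η N^η)^8`; Shimizu (`volume_fd_eq_holds`): `vol(X.fd) = (π/3)φ(D')ψ(M)
≤ (π/3) N · 2^{ω(M)} ≤ (π/3) N · d(N) ≤ C_η N^{1+η}`.  Hence `log P.deg + log covol(Λ_E) ≥ log vol − 12η log N − C`. -/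
theorem stub_shimuraDegreeLowerBoundOfPaired :
    Literature.NumberTheory.Automorphic.PastenShimura2024_thm_6_1 →
    Literature.NumberTheory.Automorphic.exists_optimal_modularParametrizationData →
    Literature.NumberTheory.EllipticCurves.ModularForms.murty_petersson_newform_lower_bound →
    Summit.ABC.ABC.Theses.RibetTakahashiSplit.MazurKenkuRadius →
    (∀ ε : ℝ, 0 < ε → ∃ C : ℝ, ∀ (W : WeierstrassCurve ℚ) [W.IsElliptic],
      (∀ p : ℕ, p.Prime → p ≠ 2 → ¬ p ^ 2 ∣ W.conductorNorm ℤ) →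
      ∀ D : Finset ℕ,
        (D ⊆ (W.conductorNorm ℤ).primeFactors.filter (fun p => ¬ p ^ 2 ∣ W.conductorNorm ℤ) ∧
          Even D.card ∧ 2 ≤ D.card ∧
          2 ≤ ((W.conductorNorm ℤ).primeFactors.filter (fun p => ¬ p ^ 2 ∣ W.conductorNorm ℤ) \
            D).card) →
        ((∏ p ∈ D, (W.minimalDiscriminantNorm ℤ).factorization p : ℕ) : ℝ) ≤
          C * (W.conductorNorm ℤ : ℝ) ^ ε) →
    ∀ ε : ℝ, 0 < ε → ∃ C : ℝ, ∀ (W : WeierstrassCurve ℚ) [W.IsElliptic] [W.IsGloballyMinimal],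
      (∀ p : ℕ, p.Prime → p ≠ 2 → ¬ p ^ 2 ∣ W.conductorNorm ℤ) →
      ∀ D : Finset ℕ,
        (D ⊆ (W.conductorNorm ℤ).primeFactors.filter (fun p => ¬ p ^ 2 ∣ W.conductorNorm ℤ) ∧
          Even D.card ∧ 2 ≤ D.card ∧
          2 ≤ ((W.conductorNorm ℤ).primeFactors.filter (fun p => ¬ p ^ 2 ∣ W.conductorNorm ℤ) \
            D).card) →
      ∀ M : ℕ, (∏ p ∈ D, p) * M = W.conductorNorm ℤ →
      ∀ (X : Literature.NumberTheory.Automorphic.ShimuraCurveData (∏ p ∈ D, p) M)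
        (P : Literature.NumberTheory.Automorphic.ShimuraParametrizationData X W),
        Real.log (MeasureTheory.volume X.fd).toReal - Real.log (ZLattice.covolume P.L.lattice) -
          (ε * Real.log (W.conductorNorm ℤ) + C) ≤ Real.log (P.deg : ℝ) :=
  Summit.ABC.ABC.Theorems.ManyPrimeValuationProduct.stub_shimuraDegreeLowerBoundOfPaired

/-! ## Rev c2 (lead c2): the HYPOTHESIS-FREE RUNG of stub 4, PROVED — Frey's identity for every
period-lattice form, and the unconditional floor it puts under `MeanSquareLowerBound`

`PeriodFormDegree` (registered stub `stub_periodFormDegree`, tree vocabulary; PROVED in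
`Theorems/RibetTakahashiSplitManyPrimeValuationProductStubPeriodFormDegree.lean`, p117508, from the tree's
`ShimuraCurveData.exists_deg_of_hasPeriodsIn` + the area formula with multiplicity + `Λ`-tiling): for
`1 < D`, EVERY non-zero `s ∈ S₂(X.Gamma)` with periods in `Λ_L` and EVERY fundamental domain `F`
satisfy `∫_F ‖s‖²y² dμ = d · covol(Λ_L)` with an integer `d ≥ 1` (and the mean square is integrable).
Consequences under the EXACT quantifiers of the lever (`meanSquare_floor`, PROVED): the side conditions
`IntegrableOn (pet s) F`, `0 < ∫_F pet s` hold automatically, and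
  `log((vol F)⁻¹ ∫_F ‖s‖²_pt) ≥ log covol(Λ_L) − log vol(F)`.
With the package (`logValProd_le_of_package_of_floor`, PROVED): for every curve with the Fermat input and
every covering set, `log T_D ≤ C + ε log N + log vol(F) − log covol(Λ_E)` for the package's Néron pair —
`T_D ≤ e^C N^ε · vol(X_0^D(M)) / covol(Λ_E)`, the Faltings-height rung (`covol(Λ_E) = e^{−2h_F(E)}·const`).
So the OPEN content of stub 4 is exactly: the Néron-period JL form beats the degree-one floor by the
factor `vol(X_0^D(M))·N^{−ε}/covol(Λ_E)`, i.e. `deg(X_0^D(M) → E_Néron-form) · covol(Λ_E) ≥ vol·N^{−ε}e^{−C}`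
— a DEGREE LOWER BOUND of degree-conjecture shape for the Shimura-curve parametrisation (Census). -/

/-- **Statement of the rev-c2 registered stub `stub_periodFormDegree`** (tree vocabulary, verbatim the
registered signature): Frey's identity with an integer degree `d ≥ 1` for every non-zero period-lattice
form on a compact Shimura curve and every fundamental domain. -/
def PeriodFormDegree : Prop :=
  ∀ {D M : ℕ}, 1 < D → ∀ (X : Literature.NumberTheory.Automorphic.ShimuraCurveData D M) (F : Set UpperHalfPlane), Literature.NumberTheory.Automorphic.IsHypFundamentalDomain X.Gamma F → ∀ (s : CuspForm X.Gamma 2), s ≠ 0 → ∀ (L : PeriodPair), Literature.NumberTheory.Automorphic.HasPeriodsIn X.Gamma s (L.lattice : Set ℂ) → MeasureTheory.IntegrableOn (fun z => ‖s z‖ ^ 2 * z.im ^ 2) F ∧ ∃ d : ℕ, 0 < d ∧ ∫ z in F, ‖s z‖ ^ 2 * z.im ^ 2 = d * ZLattice.covolume L.lattice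

/-- **Stub 5 (rev c2) — `PeriodFormDegree`, PROVED and LANDED** (p117508 ACCEPTED, commit 6b7c30002dbf:
`Summit.ABC.ABC.Theorems.ManyPrimeValuationProduct.stub_periodFormDegree`, imported; no `sorry`). -/
theorem stub_periodFormDegree : PeriodFormDegree :=
  fun hD X F hF s hs L hper =>
    Summit.ABC.ABC.Theorems.ManyPrimeValuationProduct.stub_periodFormDegree hD X F hF s hs L hper

/-- A covering set has `∏_{p ∈ D} p > 1` (it consists of `≥ 2` primes), so `X_0^{∏D}(M)` is COMPACT
and the degree theory of period-lattice forms applies. -/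
theorem one_lt_discOf {W : WeierstrassCurve ℚ} {D : Finset ℕ} (hD : IsCoveringSet W D) :
    1 < discOf D := by
  obtain ⟨hsub, -, h2, -⟩ := hD
  have hprime : ∀ p ∈ D, p.Prime := fun p hp =>
    Nat.prime_of_mem_primeFactors (Finset.mem_filter.mp (hsub hp)).1
  obtain ⟨p, hp⟩ : D.Nonempty := Finset.card_pos.mp (by omega)
  unfold discOf
  calc 1 < 2 := one_lt_two
    _ ≤ p := (hprime p hp).two_le
    _ ≤ ∏ q ∈ D, q := Finset.single_le_prod' (fun q hq => (hprime q hq).one_lt.le) hp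

/-- **The unconditional floor under the lever (PROVED from stub 5).** Under the exact quantifiers of
`MeanSquareLowerBound` (indeed fewer: no Néron condition, no log-integrability, no a.e. positivity), for
every covering set `D`, datum `S` of level `(∏D, N/∏D)`, fundamental domain `F` of finite positive volume,
and non-zero `s` with periods in `Λ_L`: `pet s` is integrable on `F`, `∫_F pet s > 0`, and
`log covol(Λ_L) − log vol(F) ≤ log((vol F)⁻¹ ∫_F pet s)`. -/
theorem meanSquare_floor (hfloor : PeriodFormDegree) :
    ∀ (W : WeierstrassCurve ℚ) (D : Finset ℕ), IsCoveringSet W D →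
    ∀ (L : PeriodPair) (S : ShimuraCurveData (discOf D) (W.conductorNorm ℤ / discOf D))
      (F : Set UpperHalfPlane), IsHypFundamentalDomain S.Gamma F → volume F ≠ 0 → volume F ≠ ⊤ →
    ∀ (s : CuspForm S.Gamma 2), s ≠ 0 → HasPeriodsIn S.Gamma s (L.lattice : Set ℂ) →
      IntegrableOn (pet s) F ∧ (0 < ∫ z in F, pet s z) ∧
        Real.log (ZLattice.covolume L.lattice) - Real.log (volume F).toReal ≤
          Real.log ((volume F).toReal⁻¹ * ∫ z in F, pet s z) := by
  intro W D hD L S F hF hF0 hFt s hs hper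
  obtain ⟨hint, d, hd, heq⟩ := hfloor (one_lt_discOf hD) S F hF s hs L hper
  have hV : 0 < (volume F).toReal := ENNReal.toReal_pos hF0 hFt
  have hcov : 0 < ZLattice.covolume L.lattice := ZLattice.covolume_pos _ _
  have hI : ZLattice.covolume L.lattice ≤ ∫ z in F, pet s z := by
    change _ ≤ ∫ z in F, ‖s z‖ ^ 2 * z.im ^ 2
    rw [heq]
    have h1 : (1 : ℝ) ≤ d := by exact_mod_cast hd
    nlinarith
  have hIpos : 0 < ∫ z in F, pet s z := hcov.trans_le hI
  refine ⟨hint, hIpos, ?_⟩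
  rw [Real.log_mul (inv_ne_zero hV.ne') hIpos.ne', Real.log_inv]
  have := Real.log_le_log hcov hI
  linarith

/-- **The Faltings-height rung (PROVED from the package + stub 5).** For every `ε > 0` there is `C`
such that for every curve semistable away from `2` with the Fermat input and every covering set `D`, the
package's Néron pair `L`, datum `S` and domain `F` satisfy
`log T_D ≤ C + ε log N + log vol(F) − log covol(Λ_E)`, i.e. `T_D ≤ e^C N^ε vol(X_0^D(M))/covol(Λ_E)`:
the package inequality with `∫_F ‖s‖² ≥ covol(Λ_E)` (degree `≥ 1`). The crux per covering set is the
same inequality with `log vol(F) − log covol(Λ_E)` replaced by `ε log N + C` — the whole open content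
of stub 4 is that gap. -/
theorem logValProd_le_of_package_of_floor (hJL : JLPackage) (hfloor : PeriodFormDegree) :
    ∀ ε : ℝ, 0 < ε → ∃ C : ℝ, ∀ (W : WeierstrassCurve ℚ) [W.IsElliptic],
      IsSemistableAwayFromTwo W → FermatInput W → ∀ D : Finset ℕ, IsCoveringSet W D →
        ∃ (L : PeriodPair) (S : ShimuraCurveData (discOf D) (W.conductorNorm ℤ / discOf D))
          (F : Set UpperHalfPlane),
          IsNeronPeriodPairOf W L ∧ IsHypFundamentalDomain S.Gamma F ∧ volume F ≠ 0 ∧ volume F ≠ ⊤ ∧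
          Real.log (valProd W D) ≤ C + ε * Real.log (W.conductorNorm ℤ) +
            Real.log (volume F).toReal - Real.log (ZLattice.covolume L.lattice) := by
  intro ε hε
  obtain ⟨C, hC⟩ := hJL ε hε
  refine ⟨C, fun W _ hss hFI D hD => ?_⟩
  obtain ⟨L, S, F, s, hL, hFD, hF0, hFt, hs0, hper, -, -, -, hIpos, hineq⟩ := hC W hss hFI D hD
  refine ⟨L, S, F, hL, hFD, hF0, hFt, ?_⟩
  obtain ⟨-, -, hfl⟩ := meanSquare_floor hfloor W D hD L S F hFD hF0 hFt s hs0 hper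
  have hV : 0 < (volume F).toReal := ENNReal.toReal_pos hF0 hFt
  rw [Real.log_mul (inv_ne_zero hV.ne') hIpos.ne', Real.log_inv] at hfl
  linarith

/-! ### Rev c2: the remaining side conditions of the lever are theorems (volume, a.e. positivity) -/

/-- **The area of an admissible fundamental domain is Shimizu's number**: for a datum `S` of level
`(∏D, N/∏D)` and ANY fundamental domain `F` of `S.Gamma`, `vol(F) = (π/3)·φ(∏D)·ψ(N/∏D)` (tree:
`ShimuraCurveData.volume_eq_volume_fd` — two fundamental domains have the same area — and the
discharged Shimizu–Vignéras formula `ShimuraCurveData.volume_fd_eq_holds`). -/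
theorem volume_admissible_eq {W : WeierstrassCurve ℚ} {D : Finset ℕ}
    (S : ShimuraCurveData (discOf D) (W.conductorNorm ℤ / discOf D)) {F : Set UpperHalfPlane}
    (hF : IsHypFundamentalDomain S.Gamma F) :
    volume F = ENNReal.ofReal (Real.pi / 3 *
      ((Nat.totient (discOf D) *
        Literature.NumberTheory.EllipticCurves.ModularForms.gamma0Index (W.conductorNorm ℤ / discOf D) : ℕ) : ℝ)) := by
  rw [S.volume_eq_volume_fd hF]
  exact ShimuraCurveData.volume_fd_eq_holds S S.level_pos

/-- Hence every admissible fundamental domain has FINITE area … -/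
theorem volume_admissible_ne_top {W : WeierstrassCurve ℚ} {D : Finset ℕ}
    (S : ShimuraCurveData (discOf D) (W.conductorNorm ℤ / discOf D)) {F : Set UpperHalfPlane}
    (hF : IsHypFundamentalDomain S.Gamma F) : volume F ≠ ⊤ := by
  rw [volume_admissible_eq S hF]
  exact ENNReal.ofReal_ne_top

/-- … and POSITIVE area (`φ(∏D) ≥ 1`, `ψ(M) ≥ M ≥ 1`). -/
theorem volume_admissible_ne_zero {W : WeierstrassCurve ℚ} {D : Finset ℕ} (hD : IsCoveringSet W D)
    (S : ShimuraCurveData (discOf D) (W.conductorNorm ℤ / discOf D)) {F : Set UpperHalfPlane}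
    (hF : IsHypFundamentalDomain S.Gamma F) : volume F ≠ 0 := by
  rw [volume_admissible_eq S hF, ne_eq, ENNReal.ofReal_eq_zero, not_le]
  have hM : 0 < W.conductorNorm ℤ / discOf D := S.level_pos
  have hφ : 0 < Nat.totient (discOf D) := Nat.totient_pos.mpr (by have := one_lt_discOf hD; omega)
  have hψ : 0 < Literature.NumberTheory.EllipticCurves.ModularForms.gamma0Index
      (W.conductorNorm ℤ / discOf D) :=
    lt_of_lt_of_le hM (Summit.ABC.ABC.Theorems.ManyPrimeValuationProduct.JLPackage.le_gamma0Index _ hM.ne')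
  have : (0 : ℝ) < ((Nat.totient (discOf D) *
      Literature.NumberTheory.EllipticCurves.ModularForms.gamma0Index (W.conductorNorm ℤ / discOf D) : ℕ) : ℝ) := by
    exact_mod_cast Nat.mul_pos hφ hψ
  positivity

/-- **A.e. positivity of `‖s‖²_pt` for `s ≠ 0` on ANY set**: the zero set of a non-zero cusp form is
countable (isolated zeros), hence null for the hyperbolic measure. -/
theorem ae_pos_pet {Γ : Subgroup (GL (Fin 2) ℝ)} (s : CuspForm Γ 2) (hs : s ≠ 0)
    (F : Set UpperHalfPlane) : ∀ᵐ z ∂(volume.restrict F), 0 < pet s z := by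
  have hs' : (⇑s : UpperHalfPlane → ℂ) ≠ 0 := fun h => hs (by ext τ; simpa using congrFun h τ)
  have hnull : volume {z : UpperHalfPlane | s z = 0} = 0 :=
    volume_eq_zero_of_image_coe
      (((Literature.NumberTheory.EllipticCurves.ModularForms.countable_setOf_cuspForm_eq_zero s
        hs').image _).measure_zero _)
  refine ae_restrict_of_ae ((measure_eq_zero_iff_ae_notMem.mp hnull).mono fun z hz => ?_)
  simp only [Set.mem_setOf_eq] at hz
  have : 0 < ‖s z‖ := norm_pos_iff.mpr hz
  unfold pet
  have hy : 0 < z.im := z.im_pos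
  positivity

/-- **The CLEAN lever** (rev c2): `MeanSquareLowerBound` with every AUTOMATIC hypothesis removed —
`vol F ≠ 0, ∞` (Shimizu), `IntegrableOn (pet s) F` and `0 < ∫_F pet s` (stub 5, Frey's identity),
a.e. positivity (isolated zeros); only the `log`-integrability of `‖s‖²_pt` on `F` is kept (true as
well — tree fact `shimuraCurve_pet_pos_ae_and_log_integrable` on `X.fd` — but not transferred to a
general `F` here).  This is the statement to file when stub 4 is promoted to an item. -/
def MeanSquareLowerBoundClean : Prop :=
  ∀ ε : ℝ, 0 < ε → ∃ C : ℝ, ∀ (W : WeierstrassCurve ℚ) [W.IsElliptic],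
    IsSemistableAwayFromTwo W → ∀ D : Finset ℕ, IsCoveringSet W D →
    ∀ (L : PeriodPair), IsNeronPeriodPairOf W L →
    ∀ (S : ShimuraCurveData (discOf D) (W.conductorNorm ℤ / discOf D)) (F : Set UpperHalfPlane),
      IsHypFundamentalDomain S.Gamma F →
    ∀ (s : CuspForm S.Gamma 2), s ≠ 0 → HasPeriodsIn S.Gamma s (L.lattice : Set ℂ) →
      IntegrableOn (fun z => Real.log (pet s z)) F →
        -(ε * Real.log (W.conductorNorm ℤ) + C) ≤
          Real.log ((volume F).toReal⁻¹ * ∫ z in F, pet s z)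

/-- **Registered lever ⟺ clean lever (PROVED, rev c2).** -/
theorem meanSquareLowerBound_iff_clean (hfloor : PeriodFormDegree) :
    MeanSquareLowerBound ↔ MeanSquareLowerBoundClean := by
  constructor
  · intro hM ε hε
    obtain ⟨C, hC⟩ := hM ε hε
    refine ⟨C, fun W _ hss D hD L hL S F hFD s hs0 hper hlog => ?_⟩
    have hF0 := volume_admissible_ne_zero hD S hFD
    have hFt := volume_admissible_ne_top S hFD
    obtain ⟨hint, hI, -⟩ := meanSquare_floor hfloor W D hD L S F hFD hF0 hFt s hs0 hper
    exact hC W hss D hD L hL S F hFD hF0 hFt s hs0 hper hlog hint (ae_pos_pet s hs0 F) hI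
  · intro hM ε hε
    obtain ⟨C, hC⟩ := hM ε hε
    exact ⟨C, fun W _ hss D hD L hL S F hFD _ _ s hs0 hper hlog _ _ _ =>
      hC W hss D hD L hL S F hFD s hs0 hper hlog⟩

/-- **Statement of the rev-c2 registered stub `stub_periodFormInvariance`** (tree vocabulary, verbatim
the registered signature): the mean square of a non-zero period-lattice form is the same over any two
fundamental domains (`D > 1`). PROVED in
`Theorems/RibetTakahashiSplitManyPrimeValuationProductStubPeriodFormInvariance.lean` (same degree `d`). -/
def PeriodFormInvariance : Prop :=
  ∀ {D M : ℕ}, 1 < D →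
    ∀ (X : Literature.NumberTheory.Automorphic.ShimuraCurveData D M) (F F' : Set UpperHalfPlane),
      Literature.NumberTheory.Automorphic.IsHypFundamentalDomain X.Gamma F →
      Literature.NumberTheory.Automorphic.IsHypFundamentalDomain X.Gamma F' →
    ∀ (s : CuspForm X.Gamma 2), s ≠ 0 → ∀ (L : PeriodPair),
      Literature.NumberTheory.Automorphic.HasPeriodsIn X.Gamma s (L.lattice : Set ℂ) →
      ∫ z in F, ‖s z‖ ^ 2 * z.im ^ 2 = ∫ z in F', ‖s z‖ ^ 2 * z.im ^ 2

/-- **Stub 6 (rev c2) — `PeriodFormInvariance`, PROVED and LANDED** (p117917 ACCEPTED, commit ffc813503f65: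
`Summit.ABC.ABC.Theorems.ManyPrimeValuationProduct.stub_periodFormInvariance`, imported; no `sorry`). -/
theorem stub_periodFormInvariance : PeriodFormInvariance :=
  fun hD X F F' hF hF' s hs L hper =>
    Summit.ABC.ABC.Theorems.ManyPrimeValuationProduct.stub_periodFormInvariance hD X F F' hF hF' s hs L hper

/-- **The FULLY CLEAN lever** (rev c2): no analytic side condition at all — for every `ε > 0` there is
`C` such that for every elliptic `W/ℚ` semistable away from `2`, covering set `D`, Néron period pair `L`,
datum `S` of level `(∏D, N/∏D)`, fundamental domain `F` and non-zero `s ∈ S₂(S.Gamma)` with periods in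
`Λ_L`: `log((vol F)⁻¹ ∫_F ‖s‖²_pt) ≥ −(ε log N + C)`.  Equivalent to the registered lever
(`meanSquareLowerBound_iff_clean'`): `vol F` and `∫_F ‖s‖²_pt` do not depend on `F` (Shimizu / stub 6),
and on the datum's own `S.fd` the `log`-integrability and a.e. positivity are the discharged tree fact
`shimuraCurve_pet_pos_ae_and_log_integrable`.  THIS is the statement to file when stub 4 is promoted
(the typed `EigenformLowerBound 0` of stmt-ABC-1755 in final form). -/
def MeanSquareLowerBoundClean' : Prop :=
  ∀ ε : ℝ, 0 < ε → ∃ C : ℝ, ∀ (W : WeierstrassCurve ℚ) [W.IsElliptic],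
    IsSemistableAwayFromTwo W → ∀ D : Finset ℕ, IsCoveringSet W D →
    ∀ (L : PeriodPair), IsNeronPeriodPairOf W L →
    ∀ (S : ShimuraCurveData (discOf D) (W.conductorNorm ℤ / discOf D)) (F : Set UpperHalfPlane),
      IsHypFundamentalDomain S.Gamma F →
    ∀ (s : CuspForm S.Gamma 2), s ≠ 0 → HasPeriodsIn S.Gamma s (L.lattice : Set ℂ) →
        -(ε * Real.log (W.conductorNorm ℤ) + C) ≤
          Real.log ((volume F).toReal⁻¹ * ∫ z in F, pet s z)

/-- **Registered lever ⟺ fully clean lever (PROVED, rev c2; uses stubs 5 and 6 and the tree's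
discharged analytic fact on `S.fd`).** -/
theorem meanSquareLowerBound_iff_clean' (hfloor : PeriodFormDegree) (hinv : PeriodFormInvariance) :
    MeanSquareLowerBound ↔ MeanSquareLowerBoundClean' := by
  constructor
  · intro hM ε hε
    obtain ⟨C, hC⟩ := hM ε hε
    refine ⟨C, fun W _ hss D hD L hL S F hFD s hs0 hper => ?_⟩
    have hDisc := one_lt_discOf hD
    have hfd := S.isHypFundamentalDomain_fd
    have hF0 := volume_admissible_ne_zero hD S hfd
    have hFt := volume_admissible_ne_top S hfd
    obtain ⟨hint, hI, -⟩ := meanSquare_floor hfloor W D hD L S S.fd hfd hF0 hFt s hs0 hper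
    obtain ⟨hpos, hlog⟩ := shimuraCurve_pet_pos_ae_and_log_integrable_holds S s hDisc hs0
    have h := hC W hss D hD L hL S S.fd hfd hF0 hFt s hs0 hper hlog hint hpos hI
    have hvol : volume F = volume S.fd := S.volume_eq_volume_fd hFD
    have hIeq : ∫ z in F, pet s z = ∫ z in S.fd, pet s z := hinv hDisc S F S.fd hFD hfd s hs0 L hper
    rw [hvol, hIeq]
    exact h
  · intro hM ε hε
    obtain ⟨C, hC⟩ := hM ε hε
    exact ⟨C, fun W _ hss D hD L hL S F hFD _ _ s hs0 hper _ _ _ _ =>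
      hC W hss D hD L hL S F hFD s hs0 hper⟩

/-- **The lever in DEGREE form** (rev c2). By stub 5 every admissible `s` has `∫_F ‖s‖²_pt = d·covol(Λ_L)`
for an integer `d = d(s) ≥ 1` — the degree of `Γ∖ℍ → ℂ/Λ_L`, `Γτ ↦ ∫^τ s`; for the pulled-back Néron
differential of a Shimura-curve parametrisation it is `deg φ_{D,M}` up to the isogeny/Manin bookkeeping of
the package. In these terms the lever reads: `log d(s) ≥ log vol(F) − log covol(Λ_E) − ε log N − C`, i.e.
`d(s) ≥ e^{−C} N^{−ε} · vol(X_0^D(M)) · e^{2 h_F(E)}·(2π)^{-2}…` — the degree of every Néron-period form must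
grow with the Faltings height of `E` exactly as the modular degree does (Frey–Zagier + GHL on `X_0(N)`:
`deg φ_N = 4π²c²(f,f)/covol(Λ_E) = N^{1+o(1)}/covol(Λ_E)`), which through Ribet–Takahashi is `T_D ≤ N^{o(1)}`
once more.  Geometric (curve-only) input cannot supply this: it is uniform in `Λ`, hence capped at the
gonality scale `d ≳ λ₁·vol` (Li–Yau), blind to `covol(Λ_E)`. -/
def NeronDegreeBound : Prop :=
  ∀ ε : ℝ, 0 < ε → ∃ C : ℝ, ∀ (W : WeierstrassCurve ℚ) [W.IsElliptic],
    IsSemistableAwayFromTwo W → ∀ D : Finset ℕ, IsCoveringSet W D →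
    ∀ (L : PeriodPair), IsNeronPeriodPairOf W L →
    ∀ (S : ShimuraCurveData (discOf D) (W.conductorNorm ℤ / discOf D)) (F : Set UpperHalfPlane),
      IsHypFundamentalDomain S.Gamma F → volume F ≠ 0 → volume F ≠ ⊤ →
    ∀ (s : CuspForm S.Gamma 2), s ≠ 0 → HasPeriodsIn S.Gamma s (L.lattice : Set ℂ) →
      IntegrableOn (fun z => Real.log (pet s z)) F → IntegrableOn (pet s) F →
      (∀ᵐ z ∂(volume.restrict F), 0 < pet s z) → (0 < ∫ z in F, pet s z) →
    ∀ d : ℕ, (∫ z in F, pet s z) = d * ZLattice.covolume L.lattice →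
      Real.log (volume F).toReal - Real.log (ZLattice.covolume L.lattice) -
        (ε * Real.log (W.conductorNorm ℤ) + C) ≤ Real.log d

/-- **Lever ⟺ degree bound (PROVED, via stub 5).** `log((vol F)⁻¹ ∫_F pet s) = log d(s) + log covol − log vol`. -/
theorem meanSquareLowerBound_iff_neronDegreeBound (hfloor : PeriodFormDegree) :
    MeanSquareLowerBound ↔ NeronDegreeBound := by
  constructor
  · intro hM ε hε
    obtain ⟨C, hC⟩ := hM ε hε
    refine ⟨C, fun W _ hss D hD L hL S F hFD hF0 hFt s hs0 hper hlog hint hpos hI d hd => ?_⟩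
    have h := hC W hss D hD L hL S F hFD hF0 hFt s hs0 hper hlog hint hpos hI
    have hV : 0 < (volume F).toReal := ENNReal.toReal_pos hF0 hFt
    have hcov : 0 < ZLattice.covolume L.lattice := ZLattice.covolume_pos _ _
    have hdpos : (0 : ℝ) < d := by
      have hprod : (0 : ℝ) < d * ZLattice.covolume L.lattice := by rw [← hd]; exact hI
      rcases pos_and_pos_or_neg_and_neg_of_mul_pos hprod with ⟨h1, -⟩ | ⟨-, h2⟩
      · exact h1
      · exact absurd h2 (not_lt.mpr hcov.le)
    rw [hd, Real.log_mul (inv_ne_zero hV.ne') (by positivity), Real.log_inv,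
      Real.log_mul hdpos.ne' hcov.ne'] at h
    linarith
  · intro hN ε hε
    obtain ⟨C, hC⟩ := hN ε hε
    refine ⟨C, fun W _ hss D hD L hL S F hFD hF0 hFt s hs0 hper hlog hint hpos hI => ?_⟩
    obtain ⟨-, d, -, hd⟩ := hfloor (one_lt_discOf hD) S F hFD s hs0 L hper
    have h := hC W hss D hD L hL S F hFD hF0 hFt s hs0 hper hlog hint hpos hI d hd
    have hV : 0 < (volume F).toReal := ENNReal.toReal_pos hF0 hFt
    have hcov : 0 < ZLattice.covolume L.lattice := ZLattice.covolume_pos _ _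
    have hdpos : (0 : ℝ) < d := by
      have hprod : (0 : ℝ) < d * ZLattice.covolume L.lattice := by
        have hI' : 0 < ∫ z in F, pet s z := hI
        change (0 : ℝ) < ∫ z in F, ‖s z‖ ^ 2 * z.im ^ 2 at hI'
        rwa [hd] at hI'
      rcases pos_and_pos_or_neg_and_neg_of_mul_pos hprod with ⟨h1, -⟩ | ⟨-, h2⟩
      · exact h1
      · exact absurd h2 (not_lt.mpr hcov.le)
    change -(ε * Real.log (W.conductorNorm ℤ) + C) ≤
      Real.log ((volume F).toReal⁻¹ * ∫ z in F, ‖s z‖ ^ 2 * z.im ^ 2)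
    rw [hd, Real.log_mul (inv_ne_zero hV.ne') (by positivity), Real.log_inv,
      Real.log_mul hdpos.ne' hcov.ne']
    linarith

/- The landed calibration BY NAME (p117706): `Summit.ABC.ABC.Theorems.ManyPrimeValuationProduct.manyPrimeValuationProduct_of_lever`
   has type literally `FermatInputOnClass → JLPackage → MeanSquareLowerBound → crux` (definitional unfolding; checked in the
   lead's work/tmp/SkelDefeqTest.lean).  It is NOT restated here as a theorem: `ManyPrimeValuationProduct_of` must stay this
   file's only crux-concluding declaration (skeleton check).  The converse link `meanSquareLowerBound_of_lowerPackage_of_paired'`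
   is stated below, after `JLLowerPackage`. -/

/-! ## Rev c3 (continuation lead prover-line-stmt-ABC-1561-c3-0, 2026-08-16T18Z): stub 3 on the
WHOLE class modulo cited theorems — Pasten's Thm 6.1 (b′) performed in the tree

Since rev c2 the Literature tree PERFORMED Pasten §6.6–6.9 (arXiv:1705.09251): Lemma 6.14, Lemmas
6.15–6.16, Thm 6.17′ and the telescoping of §6.9, in the generality in which the printed proof runs —
`Literature.NumberTheory.Automorphic.PastenShimura2024_thm_6_1_b'`
(`Literature/NumberTheory/Automorphic/ShimuraCurveRibetTakahashiCokernelProofs.lean`): "Thm 6.1 (b′)",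
the conclusion of Thm 6.1 (b) (`δ_{1,N}·b = a·δ_{D,M}·T_D`, `b ∣ κ^{ω(D)}`) for EVERY curve semistable
away from a finite set `S`, satisfying the Fermat input, and every admissible `N = DM` whose `M` does
not have exactly one multiplicative prime — conditionally on the external theorems its proof quotes
(Ribet–Takahashi 1997 Thm 2 = Prop 6.13, the Eisenstein property + Lemma 6.7 = Lemma 6.14, `j_p ∣ #Φ_p`,
Mazur–Kenku = Lemma 6.8, Darmon–Granville = Lemma 6.10, the Jacquet–Langlands existence fact and the
`D = 1` bridge).  This is exactly the input the skeleton's `JLPackage` needs on the crux's FULL class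
(the printed Thm 6.1 (b) covers only (b.1) semistable / (b.2) Frey–Hellegouarch curves, which is why
stub 3 was so far certified only on the PRINTED class: `jlPackage_printedClass_of_facts`,
`Theorems/RibetTakahashiSplitManyPrimeValuationProductJLPackagePrintedClass.lean`, eleven named facts).
Four of those eleven facts are meanwhile DISCHARGED (`nonempty_shimuraCurveData_holds`,
`ShimuraCurveData.volume_fd_eq_holds`, `ShimuraParametrizationData.normSq_form_eq_deg_mul_covolume_holds`,
`shimuraCurve_pet_pos_ae_and_log_integrable_holds`) and a fifth is reduced to Mazur–Kenku
(`ShimuraParametrizationData.minimalDegree_le_163_mul_of_mazurKenku`).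

Rev c3 therefore registers stub 7 `stub_jlPackageAwayFromTwo` (wave of this cycle): the skeleton's
`JLPackage` (unfolded) on the WHOLE class from SEVEN hypotheses — the Thm 6.1 (b′) conclusion at `S = {2}`
(`PastenThm61bAwayFromTwo`, the literal specialisation of the tree theorem's conclusion) and six cited
theorems: Jacquet–Langlands existence (`nonempty_shimuraParametrizationData`), the optimal `X₀(N)`-quotient
(`exists_optimal_modularParametrizationData`), Pasten Cor 10.2 = the Manin bound at `S = {2}`
(`PastenShimura2024_cor_10_2`), `‖f‖² ≪ N log N` (`murty_petersson_newform_upper_bound`), the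
Faltings + Mazur–Kenku height comparison (`abs_neronLatticeHeight_sub_le_of_isIsogenous`) and Mazur–Kenku
(`mazurKenku_exists_cyclic_isogeny`).  `jlPackage_of_facts` is the one-line bridge to `JLPackage`, and
`pairedFactorisationBound_of_facts` the honest whole-class summary: modulo CITED theorems the crux per
covering set is [stub 4, the lever, OPEN crux-sized] + [stub 2, the residual Fermat input, OPEN].
`ManyPrimeValuationProduct_of` and stubs 1–4 are byte-identical to rev c1/c2.

REV C4 HYGIENE (planner directions 119dc57d / a78bdf90): the rev-c3 declarations `stub_jlPackageAwayFromTwo` (alias of the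
landed p119506), `jlPackage_of_facts` and `pairedFactorisationBound_of_facts` — the only ones typing the XL facts
`abs_neronLatticeHeight_sub_le_of_isIsogenous` / `mazurKenku_exists_cyclic_isogeny` — are REMOVED from the skeleton together
with the imports `RationalIsogenyDegrees`, `ShimuraCurveMinimalDegreeIsogenyBoundProofs`, `Theorems…JLPackageAwayFromTwo`; their
radius successors are `stub_jlDegreePackageOfRadius` (p121499), `jlPackage_of_facts_radius`, `pairedFactorisationBound_of_facts_radius`.
`PastenThm61bAwayFromTwo` stays (h61 of stub 8); the landed Theorems file p119506 is untouched. -/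

/-- **Pasten's Thm 6.1 (b′) at `S = {2}`** — the literal specialisation of the conclusion of the tree
theorem `Literature.NumberTheory.Automorphic.PastenShimura2024_thm_6_1_b'` (arXiv:1705.09251 Thm 6.1 (b)
p. 20 with its proof §6.9 p. 25 and Thm 6.17 p. 24 run for curves semistable away from `S = {2}` with the
Fermat input): an integer `κ ≥ 1` supported on primes `≤ 163` such that for every admissible `N = DM`,
every datum `X` of level `(D, M)`, every globally minimal `W` of conductor `N` that is semistable away
from `2`, satisfies the Fermat input and whose `M` does not have exactly one multiplicative prime, every
class-minimal classical datum `D₁` carrying the newform of `W` and every Shimura datum `P` realising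
`δ_{D,M}`: `δ_{1,N} · b = a · deg P · ∏_{p ∣ D} v_p(Δ_min)` with `a, b ≥ 1`, `b ∣ κ^{ω(D)}`.
Discharge (Literature side): `PastenShimura2024_thm_6_1_b'` at `S = {2}` from its inputs (component-group
data `cI, cJ`, Ribet–Takahashi Thm 2, `j ∣ #Φ`, Lemma 6.8, Lemma 6.14, Jacquet–Langlands, the `D = 1`
bridge, Lemma 6.10 at `S = {2}`). -/
def PastenThm61bAwayFromTwo : Prop :=
  ∃ κ : ℕ, 1 ≤ κ ∧ (∀ q ∈ κ.primeFactors, q ≤ 163) ∧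
    ∀ {N D M : ℕ} [NeZero N], Literature.NumberTheory.Automorphic.IsAdmissibleFactorization N D M →
    ∀ (X : Literature.NumberTheory.Automorphic.ShimuraCurveData D M) (W : WeierstrassCurve ℚ)
      [W.IsElliptic] [W.IsGloballyMinimal],
      W.conductorNorm ℤ = N → (∀ q : ℕ, q.Prime → q ∉ ({2} : Finset ℕ) → ¬ q ^ 2 ∣ N) →
      (∀ ℓ : ℕ, ℓ.Prime → 11 ≤ ℓ → ∃ r : ℕ, r.Prime ∧ r ∣ N ∧ ¬ r ^ 2 ∣ N ∧
        ¬ ℓ ∣ (W.minimalDiscriminantNorm ℤ).factorization r) →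
      (M.primeFactors.filter fun t => ¬ t ^ 2 ∣ N).card ≠ 1 →
    ∀ (W₁ : WeierstrassCurve ℚ) [W₁.IsElliptic]
      (D₁ : Literature.NumberTheory.EllipticCurves.ModularForms.ModularParametrizationData W₁ N),
      Literature.NumberTheory.EllipticCurves.ModularForms.IsNewformOf W D₁.f →
      (∀ (W₂ : WeierstrassCurve ℚ) [W₂.IsElliptic]
          (D₂ : Literature.NumberTheory.EllipticCurves.ModularForms.ModularParametrizationData W₂ N),
          D₂.f = D₁.f → D₁.modularDegree ≤ D₂.modularDegree) →
    ∀ (W' : WeierstrassCurve ℚ) [W'.IsElliptic]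
      (P : Literature.NumberTheory.Automorphic.ShimuraParametrizationData X W'),
      P.IsMinimalFor W →
        ∃ a b : ℕ, 0 < a ∧ 0 < b ∧ b ∣ κ ^ D.primeFactors.card ∧
          D₁.modularDegree * b =
            a * P.deg * ∏ p ∈ D.primeFactors, (W.minimalDiscriminantNorm ℤ).factorization p




/-! ## Jensen's inequality for `log` on a set of finite positive measure (PROVED) -/

/-- **Jensen for the logarithm** (`mean log u ≤ log mean u`), in the set-integral form the
composition consumes: `u` and `log u` integrable on `F`, `0 < μ F < ∞`, `u > 0` a.e. on `F`,
`∫_F u > 0`. Proof: `log u ≤ log m + u/m − 1` pointwise a.e. (`m` = the mean), integrate. -/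
theorem jensen_log {α : Type*} [MeasurableSpace α] {μ : Measure α} {F : Set α} {u : α → ℝ}
    (hF0 : μ F ≠ 0) (hFtop : μ F ≠ ⊤) (hu : IntegrableOn u F μ)
    (hlu : IntegrableOn (fun z => Real.log (u z)) F μ)
    (hpos : ∀ᵐ z ∂(μ.restrict F), 0 < u z) (hint : 0 < ∫ z in F, u z ∂μ) :
    (μ F).toReal⁻¹ * ∫ z in F, Real.log (u z) ∂μ ≤
      Real.log ((μ F).toReal⁻¹ * ∫ z in F, u z ∂μ) := by
  set V : ℝ := (μ F).toReal with hV
  set I : ℝ := ∫ z in F, u z ∂μ with hI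
  have hVpos : 0 < V := ENNReal.toReal_pos hF0 hFtop
  set m : ℝ := V⁻¹ * I with hm
  have hmpos : 0 < m := mul_pos (inv_pos.mpr hVpos) hint
  haveI : IsFiniteMeasure (μ.restrict F) := ⟨by rwa [Measure.restrict_apply_univ, lt_top_iff_ne_top]⟩
  -- pointwise: log u ≤ (log m - 1) + u / m, almost everywhere on F
  have hpt : ∀ᵐ z ∂(μ.restrict F), Real.log (u z) ≤ (Real.log m - 1) + u z / m := by
    filter_upwards [hpos] with z hz
    have h1 : Real.log (u z / m) ≤ u z / m - 1 := Real.log_le_sub_one_of_pos (div_pos hz hmpos)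
    rw [Real.log_div hz.ne' hmpos.ne'] at h1
    linarith
  have hgi : Integrable (fun z => (Real.log m - 1) + u z / m) (μ.restrict F) :=
    (integrable_const _).add (hu.div_const m)
  have hle : ∫ z in F, Real.log (u z) ∂μ ≤ ∫ z in F, ((Real.log m - 1) + u z / m) ∂μ :=
    integral_mono_ae hlu hgi hpt
  have hrhs : ∫ z in F, ((Real.log m - 1) + u z / m) ∂μ = V * Real.log m := by
    rw [integral_add (integrable_const _) (hu.div_const m), integral_const, integral_div,
      measureReal_restrict_apply_univ, measureReal_def, ← hV, smul_eq_mul, ← hI]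
    have hmI : I / m = V := by
      rw [hm]; field_simp [hint.ne', hVpos.ne']
    rw [hmI]; ring
  rw [hrhs] at hle
  calc V⁻¹ * ∫ z in F, Real.log (u z) ∂μ ≤ V⁻¹ * (V * Real.log m) :=
        mul_le_mul_of_nonneg_left hle (inv_nonneg.mpr hVpos.le)
    _ = Real.log m := by rw [← mul_assoc, inv_mul_cancel₀ hVpos.ne', one_mul]

/-! ## The analytic composition (PROVED): package + Jensen + zero-cycle height ⟹ the paired bound -/

/-- A covering set forces `≥ 4` multiplicative primes. -/
theorem four_le_card_multPrimes {W : WeierstrassCurve ℚ} {D : Finset ℕ} (hD : IsCoveringSet W D) :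
    4 ≤ (multPrimes W).card := by
  obtain ⟨hsub, -, h2, h2'⟩ := hD
  have h := Finset.card_sdiff_add_card_eq_card hsub
  omega

/-- **The engine of the line.** `FermatInputOnClass → JLPackage → ZeroCycleHeight →
PairedFactorisationBound`: for a covering set `D`, the package gives `(L, S, F, s)` with
`log T_D ≤ C₁ + (ε/2) log N + log vol F − log ∫_F ‖s‖²_pt`; Jensen gives
`mean_F log ‖s‖²_pt ≤ log (vol F)⁻¹ ∫_F ‖s‖²_pt`; the zero-cycle height gives
`mean_F log ‖s‖²_pt ≥ −((ε/2) log N + C₂)`; hence `log T_D ≤ C₁ + C₂ + ε log N`, i.e.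
`T_D ≤ e^{C₁+C₂} N^ε`. -/
theorem pairedFactorisationBound_of (hFI : FermatInputOnClass) (hJL : JLPackage)
    (hZ : ZeroCycleHeight) : PairedFactorisationBound := by
  intro ε hε
  have hε2 : 0 < ε / 2 := half_pos hε
  obtain ⟨C₁, hC₁⟩ := hJL (ε / 2) hε2
  obtain ⟨C₂, hC₂⟩ := hZ (ε / 2) hε2
  refine ⟨Real.exp (C₁ + C₂), fun W _ hss D hD => ?_⟩
  have hF : FermatInput W := hFI W hss (four_le_card_multPrimes hD)
  obtain ⟨L, S, F, s, hL, hFD, hF0, hFt, hs0, hper, hint₁, hint₂, hpos, hIpos, hineq⟩ :=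
    hC₁ W hss hF D hD
  have hz := hC₂ W hss D hD L hL S F hFD hF0 hFt s hs0 hper hint₂ hint₁ hpos hIpos
  have hJ := jensen_log hF0 hFt hint₁ hint₂ hpos hIpos
  set N : ℝ := (W.conductorNorm ℤ : ℝ) with hNdef
  set V : ℝ := (volume F).toReal with hVdef
  set I : ℝ := ∫ z in F, pet s z with hIdef
  have hV : 0 < V := ENNReal.toReal_pos hF0 hFt
  have hlogVI : Real.log (V⁻¹ * I) = Real.log I - Real.log V := by
    rw [Real.log_mul (inv_ne_zero hV.ne') hIpos.ne', Real.log_inv]; ring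
  rw [hlogVI] at hJ
  have hlogT : Real.log (valProd W D) ≤ C₁ + C₂ + ε * Real.log N := by linarith
  have hN0 : 0 < W.conductorNorm ℤ := W.conductorNorm_pos_holds
  have hN : 0 < N := by rw [hNdef]; exact_mod_cast hN0
  have hT : (valProd W D : ℝ) ≤ Real.exp (Real.log (valProd W D)) := by
    rcases Nat.eq_zero_or_pos (valProd W D) with h | h
    · rw [h]; simp
    · rw [Real.exp_log (by exact_mod_cast h)]
  calc (valProd W D : ℝ) ≤ Real.exp (Real.log (valProd W D)) := hT
    _ ≤ Real.exp (C₁ + C₂ + ε * Real.log N) := Real.exp_le_exp.mpr hlogT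
    _ = Real.exp (C₁ + C₂) * N ^ ε := by
        rw [Real.exp_add, Real.rpow_def_of_pos hN, mul_comm (Real.log N) ε]

/-! ## The covering glue (PROVED): the paired bound implies the crux -/

section Covering

variable (W : WeierstrassCurve ℚ)

/-- Every factor of `T(E)` is `≥ 1`: a prime of the conductor divides the minimal discriminant
(`radical_conductorNorm_eq_holds`, PROVED in the tree). -/
theorem one_le_factorization_of_mem_multPrimes [W.IsElliptic] {p : ℕ} (hp : p ∈ multPrimes W) :
    1 ≤ (W.minimalDiscriminantNorm ℤ).factorization p := by
  have hrad : UniqueFactorizationMonoid.radical (W.conductorNorm ℤ) =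
      UniqueFactorizationMonoid.radical (W.minimalDiscriminantNorm ℤ) :=
    W.radical_conductorNorm_eq_holds
  have hpf : (W.conductorNorm ℤ).primeFactors = (W.minimalDiscriminantNorm ℤ).primeFactors := by
    rw [← Nat.primeFactors_radical, hrad, Nat.primeFactors_radical]
  have hp1 : p ∈ (W.conductorNorm ℤ).primeFactors := (Finset.mem_filter.mp hp).1
  rw [hpf] at hp1
  obtain ⟨hpp, hpd, hne⟩ := Nat.mem_primeFactors.mp hp1
  exact (hpp.factorization_pos_of_dvd hne hpd)

variable {W} in
/-- Splitting a valuation product along `A ⊆ S` with `S ∖ A ⊆ B ⊆ multPrimes`: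
`T_S ≤ T_A · T_B` (all factors over multiplicative primes are `≥ 1`). -/
theorem valProd_le_mul [W.IsElliptic] {S A B : Finset ℕ} (hA : A ⊆ S) (hSB : S \ A ⊆ B)
    (hB : B ⊆ multPrimes W) : valProd W S ≤ valProd W A * valProd W B := by
  classical
  unfold valProd
  rw [← Finset.prod_sdiff hA, mul_comm]
  refine Nat.mul_le_mul_left _ ?_
  exact Finset.prod_le_prod_of_subset_of_one_le' hSB
    (fun p hp _ => one_le_factorization_of_mem_multPrimes W (hB hp))

variable {W} in
/-- **Three covering sets.** With `≥ 4` multiplicative primes there are covering sets `D₁, D₂, D₃`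
with `T(E) ≤ T_{D₁} T_{D₂} T_{D₃}`: `m` even ⇒ `S ∖ {a,b}`, `{a,b}`, `{a,b}`; `m` odd ⇒
`S ∖ {a,b,c}`, `{a,b}`, `{a,c}`. -/
theorem exists_three_coveringSets [W.IsElliptic] (h4 : 4 ≤ (multPrimes W).card) :
    ∃ D₁ D₂ D₃ : Finset ℕ, IsCoveringSet W D₁ ∧ IsCoveringSet W D₂ ∧ IsCoveringSet W D₃ ∧
      valProd W (multPrimes W) ≤ valProd W D₁ * valProd W D₂ * valProd W D₃ := by
  classical
  set S := multPrimes W with hS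
  -- three distinct multiplicative primes
  obtain ⟨a, ha⟩ : S.Nonempty := Finset.card_pos.mp (by omega)
  obtain ⟨b, hb⟩ : (S.erase a).Nonempty :=
    Finset.card_pos.mp (by rw [Finset.card_erase_of_mem ha]; omega)
  obtain ⟨c, hc⟩ : ((S.erase a).erase b).Nonempty :=
    Finset.card_pos.mp (by rw [Finset.card_erase_of_mem hb, Finset.card_erase_of_mem ha]; omega)
  have hba : b ≠ a := (Finset.mem_erase.mp hb).1
  have hbS : b ∈ S := (Finset.mem_erase.mp hb).2
  have hcb : c ≠ b := (Finset.mem_erase.mp hc).1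
  have hc' : c ∈ S.erase a := (Finset.mem_erase.mp hc).2
  have hca : c ≠ a := (Finset.mem_erase.mp hc').1
  have hcS : c ∈ S := (Finset.mem_erase.mp hc').2
  have hab : a ≠ b := hba.symm
  -- the pairs
  have hpab : ({a, b} : Finset ℕ) ⊆ S := by
    intro x hx; rcases Finset.mem_insert.mp hx with rfl | hx
    · exact ha
    · rwa [Finset.mem_singleton.mp hx]
  have hpac : ({a, c} : Finset ℕ) ⊆ S := by
    intro x hx; rcases Finset.mem_insert.mp hx with rfl | hx
    · exact ha
    · rwa [Finset.mem_singleton.mp hx]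
  have hcab : ({a, b} : Finset ℕ).card = 2 := Finset.card_pair hab
  have hcac : ({a, c} : Finset ℕ).card = 2 := Finset.card_pair hca.symm
  have covPair : ∀ {x y : ℕ}, x ≠ y → ({x, y} : Finset ℕ) ⊆ S → IsCoveringSet W {x, y} := by
    intro x y hxy hsub
    refine ⟨hsub, ?_, ?_, ?_⟩
    · rw [Finset.card_pair hxy]; exact even_two
    · rw [Finset.card_pair hxy]
    · rw [Finset.card_sdiff_of_subset hsub, Finset.card_pair hxy]; omega
  have hD₂ : IsCoveringSet W {a, b} := covPair hab hpab
  have hD₃ : IsCoveringSet W {a, c} := covPair hca.symm hpac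
  rcases Nat.even_or_odd S.card with heven | hodd
  · -- even: D₁ = S ∖ {a,b}, D₂ = D₃ = {a,b}
    refine ⟨S \ {a, b}, {a, b}, {a, b}, ?_, hD₂, hD₂, ?_⟩
    · refine ⟨Finset.sdiff_subset, ?_, ?_, ?_⟩
      · rw [Finset.card_sdiff_of_subset hpab, hcab]
        exact (Nat.even_sub (by omega)).mpr (by simp [heven])
      · rw [Finset.card_sdiff_of_subset hpab, hcab]; omega
      · rw [Finset.sdiff_sdiff_eq_self hpab, hcab]
    · have h1 : valProd W S ≤ valProd W (S \ {a, b}) * valProd W {a, b} :=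
        valProd_le_mul Finset.sdiff_subset (by rw [Finset.sdiff_sdiff_eq_self hpab]) hpab
      have h2 : 1 ≤ valProd W {a, b} := by
        unfold valProd
        exact Finset.one_le_prod' fun p hp => one_le_factorization_of_mem_multPrimes W (hpab hp)
      calc valProd W S ≤ valProd W (S \ {a, b}) * valProd W {a, b} := h1
        _ ≤ valProd W (S \ {a, b}) * valProd W {a, b} * valProd W {a, b} :=
            Nat.le_mul_of_pos_right _ h2
  · -- odd: D₁ = S ∖ {a,b,c}, D₂ = {a,b}, D₃ = {a,c}
    have hpabc : ({a, b, c} : Finset ℕ) ⊆ S := by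
      intro x hx
      rcases Finset.mem_insert.mp hx with rfl | hx
      · exact ha
      rcases Finset.mem_insert.mp hx with rfl | hx
      · exact hbS
      · rwa [Finset.mem_singleton.mp hx]
    have hcabc : ({a, b, c} : Finset ℕ).card = 3 :=
      Finset.card_eq_three.mpr ⟨a, b, c, hab, hca.symm, hcb.symm, rfl⟩
    have h5 : 5 ≤ S.card := by
      rcases hodd with ⟨k, hk⟩; omega
    refine ⟨S \ {a, b, c}, {a, b}, {a, c}, ?_, hD₂, hD₃, ?_⟩
    · refine ⟨Finset.sdiff_subset, ?_, ?_, ?_⟩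
      · rw [Finset.card_sdiff_of_subset hpabc, hcabc]
        refine (Nat.even_sub (by omega)).mpr ⟨fun h => ?_, fun h => ?_⟩
        · exact absurd h (Nat.not_even_iff_odd.mpr hodd)
        · exact absurd h (by decide)
      · rw [Finset.card_sdiff_of_subset hpabc, hcabc]; omega
      · rw [Finset.sdiff_sdiff_eq_self hpabc, hcabc]; omega
    · have h1 : valProd W S ≤ valProd W (S \ {a, b, c}) * valProd W {a, b, c} :=
        valProd_le_mul Finset.sdiff_subset (by rw [Finset.sdiff_sdiff_eq_self hpabc]) hpabc
      have hsub2 : ({a, b} : Finset ℕ) ⊆ {a, b, c} := by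
        intro x hx
        rcases Finset.mem_insert.mp hx with rfl | hx
        · exact Finset.mem_insert_self _ _
        · rw [Finset.mem_singleton.mp hx]
          exact Finset.mem_insert_of_mem (Finset.mem_insert_self _ _)
      have hrest : ({a, b, c} : Finset ℕ) \ {a, b} ⊆ {a, c} := by
        intro x hx
        have hx1 := (Finset.mem_sdiff.mp hx).1
        have hx2 := (Finset.mem_sdiff.mp hx).2
        rcases Finset.mem_insert.mp hx1 with rfl | hx1
        · exact Finset.mem_insert_self _ _
        rcases Finset.mem_insert.mp hx1 with rfl | hx1
        · exact absurd (Finset.mem_insert_of_mem (Finset.mem_singleton_self _)) hx2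
        · rw [Finset.mem_singleton.mp hx1]
          exact Finset.mem_insert_of_mem (Finset.mem_singleton_self _)
      have h2 : valProd W {a, b, c} ≤ valProd W {a, b} * valProd W {a, c} :=
        valProd_le_mul hsub2 hrest hpac
      calc valProd W S ≤ valProd W (S \ {a, b, c}) * valProd W {a, b, c} := h1
        _ ≤ valProd W (S \ {a, b, c}) * (valProd W {a, b} * valProd W {a, c}) :=
            Nat.mul_le_mul_left _ h2
        _ = valProd W (S \ {a, b, c}) * valProd W {a, b} * valProd W {a, c} := by ring

end Covering

/-- **The covering glue, PROVED**: the per-factorisation bound at `ε/3` on three covering sets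
gives the crux at `ε` (`T ≤ T_{D₁}T_{D₂}T_{D₃} ≤ (max C 1)³ N^ε`). -/
theorem coveringGlue : CoveringGlue := by
  intro hP ε hε
  obtain ⟨C, hC⟩ := hP (ε / 3) (by positivity)
  refine ⟨(max C 1) ^ 3, fun W _ hss h4 => ?_⟩
  have hS4 : 4 ≤ (multPrimes W).card := by
    refine le_trans h4 (Finset.card_le_card fun p hp => ?_)
    simp only [multPrimes, Finset.mem_filter] at hp ⊢
    exact ⟨hp.1, hp.2.2⟩
  obtain ⟨D₁, D₂, D₃, hD₁, hD₂, hD₃, hprod⟩ := exists_three_coveringSets (W := W) hS4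
  have hN0' : 0 < W.conductorNorm ℤ := W.conductorNorm_pos_holds
  set N : ℝ := (W.conductorNorm ℤ : ℝ) with hNdef
  have hN0 : 0 < N := by rw [hNdef]; exact_mod_cast hN0'
  have hb : ∀ D, IsCoveringSet W D → (valProd W D : ℝ) ≤ max C 1 * N ^ (ε / 3) := fun D hD =>
    (hC W hss D hD).trans (mul_le_mul_of_nonneg_right (le_max_left _ _) (Real.rpow_nonneg hN0.le _))
  have hTS : (∏ p ∈ (W.conductorNorm ℤ).primeFactors with ¬ p ^ 2 ∣ W.conductorNorm ℤ,
      (W.minimalDiscriminantNorm ℤ).factorization p) = valProd W (multPrimes W) := rfl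
  rw [hTS]
  have hpow : (N ^ (ε / 3)) ^ (3 : ℕ) = N ^ ε := by
    rw [← Real.rpow_natCast, ← Real.rpow_mul hN0.le]; norm_num
  calc (valProd W (multPrimes W) : ℝ) ≤ (valProd W D₁ : ℝ) * valProd W D₂ * valProd W D₃ := by
        exact_mod_cast hprod
    _ ≤ (max C 1 * N ^ (ε / 3)) * (max C 1 * N ^ (ε / 3)) * (max C 1 * N ^ (ε / 3)) := by
        gcongr
        · exact hb D₁ hD₁
        · exact hb D₂ hD₂
        · exact hb D₃ hD₃
    _ = (max C 1) ^ 3 * (N ^ (ε / 3)) ^ (3 : ℕ) := by ring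
    _ = (max C 1) ^ 3 * N ^ ε := by rw [hpow]

/-! ## Calibration (PROVED): the lever is the paired crux plus a reverse-Jensen defect bound

Triage r1-2/r1-3 doubt 1, kernel-checked in the line's own vocabulary. `DefectBound` is the scale-free
statement "`Def_F(s) := log mean_F ‖s‖²_pt − mean_F log ‖s‖²_pt ≤ ε log N + C`" for every admissible
`s`; `JLLowerPackage` is the OTHER side of the Ribet–Takahashi–Pasten identity
(`log T_D ≥ log vol F − log ∫_F ‖s‖²_pt − ε log N − C` for EVERY admissible `s`: numerator of
`γ_{D,M}` bounded by `163^{ω(D)}` unconditionally (Pasten Thm 6.1), `∫_F‖s‖² ≥ δ_{D',M}·covol Λ_E`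
for every non-zero pull-back, `(f,f) ≫ N^{1−ε}` (GHL / `murty_petersson_newform_lower_bound`),
`vol ≤ N^{1+ε}`; known in print exactly like `JLPackage`). THEN:
`PairedFactorisationBound ∧ DefectBound → ZeroCycleHeight` (`zeroCycleHeight_of_paired_of_defect`),
while `ZeroCycleHeight → PairedFactorisationBound` is `pairedFactorisationBound_of`. So, modulo the
two-sided package, the lever = [crux per covering set] ∧ [Def(s) = o(log N)]: any proof of the lever
that is not circular must control heights of the zero cycle WITHOUT passing through `T_D`. -/

/-- **Reverse-Jensen defect bound** (scale-free; the analytic half of the lever): for every admissible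
`(W, D, L, S, F, s)`, `log((vol F)⁻¹ ∫_F ‖s‖²_pt) − (vol F)⁻¹ ∫_F log ‖s‖²_pt ≤ ε log N + C`.
Random-wave heuristic: the left side tends to Euler's `γ = 0.577…`; no tool bounds it by `o(log N)`
(Donnelly–Fefferman-type bounds give `O(N)`). Tested numerically on the split side (`X_0(N)`, jobs of
this seat attached to stmt-ABC-1561). -/
def DefectBound : Prop :=
  ∀ ε : ℝ, 0 < ε → ∃ C : ℝ, ∀ (W : WeierstrassCurve ℚ) [W.IsElliptic],
    IsSemistableAwayFromTwo W → ∀ D : Finset ℕ, IsCoveringSet W D →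
    ∀ (L : PeriodPair), IsNeronPeriodPairOf W L →
    ∀ (S : ShimuraCurveData (discOf D) (W.conductorNorm ℤ / discOf D)) (F : Set UpperHalfPlane),
      IsHypFundamentalDomain S.Gamma F → volume F ≠ 0 → volume F ≠ ⊤ →
    ∀ (s : CuspForm S.Gamma 2), s ≠ 0 → HasPeriodsIn S.Gamma s (L.lattice : Set ℂ) →
      IntegrableOn (fun z => Real.log (pet s z)) F → IntegrableOn (pet s) F →
      (∀ᵐ z ∂(volume.restrict F), 0 < pet s z) → (0 < ∫ z in F, pet s z) →
        Real.log ((volume F).toReal⁻¹ * ∫ z in F, pet s z) -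
            (volume F).toReal⁻¹ * ∫ z in F, Real.log (pet s z) ≤
          ε * Real.log (W.conductorNorm ℤ) + C

/-- **The lower half of the package** (known in print; the reverse direction of Ribet–Takahashi–
Pasten + Frey–Zagier + GHL + Shimizu, for EVERY non-zero form with periods in the Néron lattice):
`log vol F − log ∫_F ‖s‖²_pt − ε log N − C ≤ log T_D`. -/
def JLLowerPackage : Prop :=
  ∀ ε : ℝ, 0 < ε → ∃ C : ℝ, ∀ (W : WeierstrassCurve ℚ) [W.IsElliptic],
    IsSemistableAwayFromTwo W → ∀ D : Finset ℕ, IsCoveringSet W D →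
    ∀ (L : PeriodPair), IsNeronPeriodPairOf W L →
    ∀ (S : ShimuraCurveData (discOf D) (W.conductorNorm ℤ / discOf D)) (F : Set UpperHalfPlane),
      IsHypFundamentalDomain S.Gamma F → volume F ≠ 0 → volume F ≠ ⊤ →
    ∀ (s : CuspForm S.Gamma 2), s ≠ 0 → HasPeriodsIn S.Gamma s (L.lattice : Set ℂ) →
      (0 < ∫ z in F, pet s z) →
        Real.log (volume F).toReal - Real.log (∫ z in F, pet s z) -
            ε * Real.log (W.conductorNorm ℤ) - C ≤ Real.log (valProd W D)

/-- `T_D ≥ 1` on covering sets (every factor is `≥ 1`). -/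
theorem one_le_valProd {W : WeierstrassCurve ℚ} [W.IsElliptic] {D : Finset ℕ}
    (hD : IsCoveringSet W D) : 1 ≤ valProd W D := by
  unfold valProd
  exact Finset.one_le_prod' fun p hp => one_le_factorization_of_mem_multPrimes W (hD.1 hp)

/-- **Calibration, PROVED.** Modulo the lower half of the package, the paired crux together with the
reverse-Jensen defect bound implies the lever:
`mean log ‖s‖² = log mean ‖s‖² − Def(s) ≥ [−log T_D − ε log N − C] − [ε log N + C]` and
`log T_D ≤ log C' + ε log N`. -/
theorem zeroCycleHeight_of_paired_of_defect (hlow : JLLowerPackage) (hP : PairedFactorisationBound)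
    (hDef : DefectBound) : ZeroCycleHeight := by
  intro ε hε
  have hε3 : 0 < ε / 3 := by positivity
  obtain ⟨C₁, hC₁⟩ := hlow (ε / 3) hε3
  obtain ⟨C₂, hC₂⟩ := hP (ε / 3) hε3
  obtain ⟨C₃, hC₃⟩ := hDef (ε / 3) hε3
  refine ⟨C₁ + |Real.log C₂| + C₃, fun W _ hss D hD L hL S F hFD hF0 hFt s hs0 hper hlog hint hpos hI => ?_⟩
  set N : ℝ := (W.conductorNorm ℤ : ℝ) with hNdef
  set V : ℝ := (volume F).toReal with hVdef
  set I : ℝ := ∫ z in F, pet s z with hIdef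
  have hV : 0 < V := ENNReal.toReal_pos hF0 hFt
  have h1 := hC₁ W hss D hD L hL S F hFD hF0 hFt s hs0 hper hI
  have h2 := hC₂ W hss D hD
  have h3 := hC₃ W hss D hD L hL S F hFD hF0 hFt s hs0 hper hlog hint hpos hI
  have hN0 : 0 < W.conductorNorm ℤ := W.conductorNorm_pos_holds
  have hN : 0 < N := by rw [hNdef]; exact_mod_cast hN0
  have hT1 : (1 : ℝ) ≤ valProd W D := by exact_mod_cast one_le_valProd hD
  -- log T_D ≤ |log C₂| + (ε/3) log N, from T_D ≤ C₂ N^{ε/3} and T_D ≥ 1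
  have hC₂pos : 0 < C₂ := by
    by_contra hle
    push Not at hle
    have : C₂ * N ^ (ε / 3) ≤ 0 := mul_nonpos_of_nonpos_of_nonneg hle (Real.rpow_nonneg hN.le _)
    linarith
  have hlogT : Real.log (valProd W D) ≤ |Real.log C₂| + ε / 3 * Real.log N := by
    have hTpos : (0 : ℝ) < valProd W D := lt_of_lt_of_le one_pos hT1
    calc Real.log (valProd W D) ≤ Real.log (C₂ * N ^ (ε / 3)) := Real.log_le_log hTpos h2
      _ = Real.log C₂ + ε / 3 * Real.log N := by
          rw [Real.log_mul hC₂pos.ne' (Real.rpow_pos_of_pos hN _).ne', Real.log_rpow hN]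
      _ ≤ |Real.log C₂| + ε / 3 * Real.log N := by linarith [le_abs_self (Real.log C₂)]
  have hlogVI : Real.log (V⁻¹ * I) = Real.log I - Real.log V := by
    rw [Real.log_mul (inv_ne_zero hV.ne') hI.ne', Real.log_inv]; ring
  rw [hlogVI] at h3
  -- assemble
  have : -(ε * Real.log N + (C₁ + |Real.log C₂| + C₃)) ≤ V⁻¹ * ∫ z in F, Real.log (pet s z) := by
    linarith
  simpa [hNdef, hVdef] using this

/-! ## The reverse-Jensen DEFECT BOUND (rev a1 stub 5; rev c1: a definition with proved calibration, no `sorry`)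

`DefectBound` — for every admissible `(W, D, L, S, F, s)`:
`log((vol F)⁻¹ ∫_F ‖s‖²_pt) − (vol F)⁻¹ ∫_F log ‖s‖²_pt ≤ ε log N + C` — is the killable analytic half of
the zero-cycle height: `ZeroCycleHeight` = `MeanSquareLowerBound` ∧ `DefectBound` modulo the package
(`zeroCycleHeight_of_paired_of_defect` above, `meanSquareLowerBound_of_zeroCycleHeight` below).  Why
plausibly true: random-wave heuristics put the defect at Euler's `γ`; on the split side `X_0(N)` it is
EQUIVALENT (Jensen's formula in the `q`-disc, `a₁ = 1`) to equidistribution of the zeros of the newform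
in the cusp strip down to the Planck scale, and the line's kit job j014837 (97 prime `N ≤ 38593`)
measured `Def_N → 0.578 ± 0.038 = γ` with slope `−0.008 ± 0.004` in `log N`
(`Lines/jl_zero_cycle_height_numerics.md`).  Why it might fail: zeros of JL eigenforms macroscopically
LOW in collar coordinates (defect `≍ c log N`), which no current theorem excludes (level-aspect QUE is
macroscopic; Donnelly–Fefferman gives `O(N)`; DEFECT-LITERATURE.md on the item: three steps beyond every
published theorem).  It survived drefute g3 (`Negative/DefectScaling.lean` p88845: scale-free, only the
Hecke/JL direction of `HasPeriodsIn` carries content).  Rev c1 de-registers it: the composition no longer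
passes through the height, so nothing in `ManyPrimeValuationProduct_of` depends on it.

## Calibration (PROVED, rev a1): the MINIMAL lever is what every line through the package must prove

`MeanSquareLowerBound` (stub 4 of rev c1, defined above): it is what the package actually consumes
(`pairedFactorisationBound_of_meanSquare`, no Jensen), it follows from the zero-cycle height by Jensen
(`meanSquareLowerBound_of_zeroCycleHeight`), and modulo the lower half of the package it FOLLOWS from the
paired crux (`meanSquareLowerBound_of_paired`): so, modulo the two-sided Ribet–Takahashi–Pasten package,
minimal lever ⟺ crux_D, and `ZeroCycleHeight` = minimal lever + `DefectBound`.  The disprover cannot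
kill the minimal lever short of `¬ABC` (Disproof §2). -/

/-- Zero-cycle height ⟹ minimal lever (Jensen: `mean log ≤ log mean`): the line's MECHANISM as a
proved sufficient condition for the registered stub 4. -/
theorem meanSquareLowerBound_of_zeroCycleHeight (hZ : ZeroCycleHeight) : MeanSquareLowerBound := by
  intro ε hε
  obtain ⟨C, hC⟩ := hZ ε hε
  refine ⟨C, fun W _ hss D hD L hL S F hFD hF0 hFt s hs0 hper hlog hint hpos hI => ?_⟩
  have hz := hC W hss D hD L hL S F hFD hF0 hFt s hs0 hper hlog hint hpos hI
  have hJ := jensen_log hF0 hFt hint hlog hpos hI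
  exact hz.trans hJ

/-- **The engine of rev c1, per curve.** Package + minimal lever ⟹ `T_D ≤ C N^ε` for every covering
set of every curve semistable away from `2` that satisfies the Fermat input (no Jensen):
`log T_D ≤ C₁ + (ε/2) log N + log V − log I = C₁ + (ε/2) log N − log(V⁻¹ I) ≤ C₁ + C₂ + ε log N`. -/
theorem pairedBoundFermat_of_meanSquare (hJL : JLPackage) (hM : MeanSquareLowerBound) :
    ∀ ε : ℝ, 0 < ε → ∃ C : ℝ, ∀ (W : WeierstrassCurve ℚ) [W.IsElliptic],
      IsSemistableAwayFromTwo W → FermatInput W → ∀ D : Finset ℕ, IsCoveringSet W D →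
        (valProd W D : ℝ) ≤ C * (W.conductorNorm ℤ : ℝ) ^ ε := by
  intro ε hε
  have hε2 : 0 < ε / 2 := half_pos hε
  obtain ⟨C₁, hC₁⟩ := hJL (ε / 2) hε2
  obtain ⟨C₂, hC₂⟩ := hM (ε / 2) hε2
  refine ⟨Real.exp (C₁ + C₂), fun W _ hss hF D hD => ?_⟩
  obtain ⟨L, S, F, s, hL, hFD, hF0, hFt, hs0, hper, hint₁, hint₂, hpos, hIpos, hineq⟩ :=
    hC₁ W hss hF D hD
  have hm := hC₂ W hss D hD L hL S F hFD hF0 hFt s hs0 hper hint₂ hint₁ hpos hIpos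
  set N : ℝ := (W.conductorNorm ℤ : ℝ) with hNdef
  set V : ℝ := (volume F).toReal with hVdef
  set I : ℝ := ∫ z in F, pet s z with hIdef
  have hV : 0 < V := ENNReal.toReal_pos hF0 hFt
  have hlogVI : Real.log (V⁻¹ * I) = Real.log I - Real.log V := by
    rw [Real.log_mul (inv_ne_zero hV.ne') hIpos.ne', Real.log_inv]; ring
  rw [hlogVI] at hm
  have hlogT : Real.log (valProd W D) ≤ C₁ + C₂ + ε * Real.log N := by linarith
  have hN0 : 0 < W.conductorNorm ℤ := W.conductorNorm_pos_holds
  have hN : 0 < N := by rw [hNdef]; exact_mod_cast hN0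
  have hT : (valProd W D : ℝ) ≤ Real.exp (Real.log (valProd W D)) := by
    rcases Nat.eq_zero_or_pos (valProd W D) with h | h
    · rw [h]; simp
    · rw [Real.exp_log (by exact_mod_cast h)]
  calc (valProd W D : ℝ) ≤ Real.exp (Real.log (valProd W D)) := hT
    _ ≤ Real.exp (C₁ + C₂ + ε * Real.log N) := Real.exp_le_exp.mpr hlogT
    _ = Real.exp (C₁ + C₂) * N ^ ε := by
        rw [Real.exp_add, Real.rpow_def_of_pos hN, mul_comm (Real.log N) ε]

/-- Minimal lever ⟹ paired bound on the whole class, given the Fermat input on the class (the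
package consumed directly, no Jensen): the composition step of `ManyPrimeValuationProduct_of`. -/
theorem pairedFactorisationBound_of_meanSquare (hFI : FermatInputOnClass) (hJL : JLPackage)
    (hM : MeanSquareLowerBound) : PairedFactorisationBound := by
  intro ε hε
  obtain ⟨C, hC⟩ := pairedBoundFermat_of_meanSquare hJL hM ε hε
  exact ⟨C, fun W _ hss D hD => hC W hss (hFI W hss (four_le_card_multPrimes hD)) D hD⟩

/-- Paired crux ⟹ minimal lever, modulo the LOWER half of the package:
`log(V⁻¹ I) = −(log V − log I) ≥ −log T_D − ε log N − C₁ ≥ −(|log C₂| + ε log N) − ε log N − C₁`. -/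
theorem meanSquareLowerBound_of_paired (hlow : JLLowerPackage) (hP : PairedFactorisationBound) :
    MeanSquareLowerBound := by
  intro ε hε
  have hε2 : 0 < ε / 2 := half_pos hε
  obtain ⟨C₁, hC₁⟩ := hlow (ε / 2) hε2
  obtain ⟨C₂, hC₂⟩ := hP (ε / 2) hε2
  refine ⟨C₁ + |Real.log C₂|, fun W _ hss D hD L hL S F hFD hF0 hFt s hs0 hper _hlog _hint _hpos hI => ?_⟩
  set N : ℝ := (W.conductorNorm ℤ : ℝ) with hNdef
  set V : ℝ := (volume F).toReal with hVdef
  set I : ℝ := ∫ z in F, pet s z with hIdef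
  have hV : 0 < V := ENNReal.toReal_pos hF0 hFt
  have h1 := hC₁ W hss D hD L hL S F hFD hF0 hFt s hs0 hper hI
  have h2 := hC₂ W hss D hD
  have hN0 : 0 < W.conductorNorm ℤ := W.conductorNorm_pos_holds
  have hN : 0 < N := by rw [hNdef]; exact_mod_cast hN0
  have hT1 : (1 : ℝ) ≤ valProd W D := by exact_mod_cast one_le_valProd hD
  have hC₂pos : 0 < C₂ := by
    by_contra hle
    push Not at hle
    have : C₂ * N ^ (ε / 2) ≤ 0 := mul_nonpos_of_nonpos_of_nonneg hle (Real.rpow_nonneg hN.le _)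
    linarith
  have hlogT : Real.log (valProd W D) ≤ |Real.log C₂| + ε / 2 * Real.log N := by
    have hTpos : (0 : ℝ) < valProd W D := lt_of_lt_of_le one_pos hT1
    calc Real.log (valProd W D) ≤ Real.log (C₂ * N ^ (ε / 2)) := Real.log_le_log hTpos h2
      _ = Real.log C₂ + ε / 2 * Real.log N := by
          rw [Real.log_mul hC₂pos.ne' (Real.rpow_pos_of_pos hN _).ne', Real.log_rpow hN]
      _ ≤ |Real.log C₂| + ε / 2 * Real.log N := by linarith [le_abs_self (Real.log C₂)]
  have hlogVI : Real.log (V⁻¹ * I) = Real.log I - Real.log V := by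
    rw [Real.log_mul (inv_ne_zero hV.ne') hI.ne', Real.log_inv]; ring
  rw [hlogVI]
  linarith

/-- **The landed converse, BY NAME** (p117706): `JLLowerPackage → PairedFactorisationBound → MeanSquareLowerBound`. -/
theorem meanSquareLowerBound_of_lowerPackage_of_paired' :
    JLLowerPackage → PairedFactorisationBound → MeanSquareLowerBound :=
  Summit.ABC.ABC.Theorems.ManyPrimeValuationProduct.meanSquareLowerBound_of_lowerPackage_of_paired

/-! ## Rev c4: the degree package and the degree lever — bridges and composition (PROVED) -/

/-- **Degree package ⟹ package** (PROVED): expose the witnesses `L := Λ_P`, `S := X`, `F := X.fd`, `s := P.form` and undo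
Frey's identity `∫_{X.fd} ‖P.form‖²y² = P.deg · covol Λ_P` (`normSq_form_eq_deg_mul_covolume_holds`); the side conditions
are theorems (`P.period_mem`, isolated zeros / `log`-integrability on `X.fd` by `shimuraCurve_pet_pos_ae_and_log_integrable_holds`,
Shimizu's volume). -/
theorem jlPackage_of_degreePackage (hJ : JLDegreePackage) : JLPackage := by
  intro ε hε
  obtain ⟨C, hC⟩ := hJ ε hε
  refine ⟨C, fun W _ hss hFI D hD => ?_⟩
  obtain ⟨C₀, hmin, X, P, hineq⟩ := hC W hss hFI D hD
  haveI := hmin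
  have hDisc : 1 < discOf D := one_lt_discOf hD
  have hnorm : X.normSq P.form = P.deg * ZLattice.covolume P.L.lattice :=
    ShimuraParametrizationData.normSq_form_eq_deg_mul_covolume_holds P
  have hV : 0 < ZLattice.covolume P.L.lattice := ZLattice.covolume_pos _ _
  have hdeg : (0 : ℝ) < P.deg := by exact_mod_cast P.deg_pos
  have hS : 0 < X.normSq P.form := by rw [hnorm]; positivity
  have hne : P.form ≠ 0 := by
    intro h0
    have : X.normSq P.form = 0 := by
      rw [h0]; simp [ShimuraCurveData.normSq, peterssonNormSq]
    exact hS.ne' this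
  have hint : IntegrableOn (pet P.form) X.fd := by
    by_contra hni
    have : X.normSq P.form = 0 := integral_undef hni
    exact hS.ne' this
  obtain ⟨hae, hlog⟩ := shimuraCurve_pet_pos_ae_and_log_integrable_holds X P.form hDisc hne
  have hfd := X.isHypFundamentalDomain_fd
  have hI : ∫ z in X.fd, pet P.form z = P.deg * ZLattice.covolume P.L.lattice := hnorm
  refine ⟨P.L, X, X.fd, P.form, ⟨C₀, hmin, P.isNeronLattice⟩, hfd, volume_admissible_ne_zero hD X hfd,
    volume_admissible_ne_top X hfd, hne, P.period_mem, hint, hlog, hae, hS, ?_⟩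
  rw [hI, Real.log_mul hdeg.ne' hV.ne']
  exact hineq

/-- **Stub 3 of revs 0–c3, now DERIVED** (rev c4): `JLPackage` from the registered degree package. -/
theorem stub_jlPackage : JLPackage :=
  jlPackage_of_degreePackage stub_jlDegreePackage

/-- **The rev-c1 lever implies the rev-c4 lever** (PROVED): specialise `MeanSquareLowerBound` to `s := P.form`, `F := X.fd`,
`L := Λ_P` (a Néron pair of the globally minimal `W` via `C = 1`) and use Frey's identity
`(vol X.fd)⁻¹ ∫ ‖P.form‖² = (vol X.fd)⁻¹ · P.deg · covol Λ_P`.  So `ShimuraDegreeLowerBound` is the WEAKER registered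
stub; the two differ exactly by the non-Hecke Néron-period forms, which the package never produces. -/
theorem shimuraDegreeLowerBound_of_meanSquareLowerBound (hM : MeanSquareLowerBound) :
    ShimuraDegreeLowerBound := by
  intro ε hε
  obtain ⟨C, hC⟩ := hM ε hε
  refine ⟨C, fun W _ _ hss D hD M hM' X P => ?_⟩
  have hDisc : 1 < discOf D := one_lt_discOf hD
  have hD0 : 0 < discOf D := by omega
  obtain rfl : M = W.conductorNorm ℤ / discOf D := by
    rw [← hM', Nat.mul_div_cancel_left M hD0]
  have hL : IsNeronPeriodPairOf W P.L := by
    refine ⟨1, ?_, ?_⟩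
    · rw [one_smul]; infer_instance
    · rw [one_smul]; exact P.isNeronLattice
  have hnorm : X.normSq P.form = P.deg * ZLattice.covolume P.L.lattice :=
    ShimuraParametrizationData.normSq_form_eq_deg_mul_covolume_holds P
  have hV : 0 < ZLattice.covolume P.L.lattice := ZLattice.covolume_pos _ _
  have hdeg : (0 : ℝ) < P.deg := by exact_mod_cast P.deg_pos
  have hS : 0 < X.normSq P.form := by rw [hnorm]; positivity
  have hne : P.form ≠ 0 := by
    intro h0
    have : X.normSq P.form = 0 := by
      rw [h0]; simp [ShimuraCurveData.normSq, peterssonNormSq]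
    exact hS.ne' this
  have hint : IntegrableOn (pet P.form) X.fd := by
    by_contra hni
    have : X.normSq P.form = 0 := integral_undef hni
    exact hS.ne' this
  obtain ⟨hae, hlog⟩ := shimuraCurve_pet_pos_ae_and_log_integrable_holds X P.form hDisc hne
  have hfd := X.isHypFundamentalDomain_fd
  have hF0 := volume_admissible_ne_zero hD X hfd
  have hFt := volume_admissible_ne_top X hfd
  have h := hC W hss D hD P.L hL X X.fd hfd hF0 hFt P.form hne P.period_mem hlog hint hae hS
  have hI : ∫ z in X.fd, pet P.form z = P.deg * ZLattice.covolume P.L.lattice := hnorm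
  have hvol : 0 < (volume X.fd).toReal := ENNReal.toReal_pos hF0 hFt
  rw [hI, Real.log_mul (inv_ne_zero hvol.ne') (by positivity), Real.log_inv,
    Real.log_mul hdeg.ne' hV.ne'] at h
  linarith

/-- **The engine of rev c4, per curve** (PROVED). Degree package + degree lever ⟹ `T_D ≤ C N^ε` for every covering set of
every curve semistable away from `2` with the Fermat input: pass to the package's global minimal model `C₀ • W` (same
conductor, same minimal discriminant, same multiplicative primes), apply the lever to its datum `P` on `X`
(`N = (∏D)·(N/∏D)` by `admissible_of_isCoveringSet`):
`log T_D ≤ C₁ + (ε/2) log N + log vol − log P.deg − log covol ≤ C₁ + C₂ + ε log N`. -/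
theorem pairedBoundFermat_of_degree (hJ : JLDegreePackage) (hL : ShimuraDegreeLowerBound) :
    ∀ ε : ℝ, 0 < ε → ∃ C : ℝ, ∀ (W : WeierstrassCurve ℚ) [W.IsElliptic],
      IsSemistableAwayFromTwo W → FermatInput W → ∀ D : Finset ℕ, IsCoveringSet W D →
        (valProd W D : ℝ) ≤ C * (W.conductorNorm ℤ : ℝ) ^ ε := by
  intro ε hε
  have hε2 : 0 < ε / 2 := half_pos hε
  obtain ⟨C₁, hC₁⟩ := hJ (ε / 2) hε2
  obtain ⟨C₂, hC₂⟩ := hL (ε / 2) hε2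
  refine ⟨Real.exp (C₁ + C₂), fun W _ hss hF D hD => ?_⟩
  obtain ⟨C₀, hmin, X, P, hineq⟩ := hC₁ W hss hF D hD
  haveI := hmin
  have hNeq : (C₀ • W).conductorNorm ℤ = W.conductorNorm ℤ := WeierstrassCurve.conductorNorm_smul_rat W C₀
  have hmult : multPrimes (C₀ • W) = multPrimes W := by unfold multPrimes; rw [hNeq]
  have hssm : IsSemistableAwayFromTwo (C₀ • W) := by
    unfold IsSemistableAwayFromTwo; rw [hNeq]; exact hss
  have hDm : IsCoveringSet (C₀ • W) D := by unfold IsCoveringSet; rw [hmult]; exact hD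
  obtain ⟨hadm, -⟩ :=
    Summit.ABC.ABC.Theorems.ManyPrimeValuationProduct.JLPackage.admissible_of_isCoveringSet hD.1 hD.2.1
  have hMeq : discOf D * (W.conductorNorm ℤ / discOf D) = (C₀ • W).conductorNorm ℤ := by
    rw [hNeq]; exact hadm.mul_eq
  have h2 := hC₂ (C₀ • W) hssm D hDm (W.conductorNorm ℤ / discOf D) hMeq X P
  rw [hNeq] at h2
  set N : ℝ := (W.conductorNorm ℤ : ℝ) with hNdef
  have hlogT : Real.log (valProd W D) ≤ C₁ + C₂ + ε * Real.log N := by linarith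
  have hN0 : 0 < W.conductorNorm ℤ := W.conductorNorm_pos_holds
  have hN : 0 < N := by rw [hNdef]; exact_mod_cast hN0
  have hT : (valProd W D : ℝ) ≤ Real.exp (Real.log (valProd W D)) := by
    rcases Nat.eq_zero_or_pos (valProd W D) with h | h
    · rw [h]; simp
    · rw [Real.exp_log (by exact_mod_cast h)]
  calc (valProd W D : ℝ) ≤ Real.exp (Real.log (valProd W D)) := hT
    _ ≤ Real.exp (C₁ + C₂ + ε * Real.log N) := Real.exp_le_exp.mpr hlogT
    _ = Real.exp (C₁ + C₂) * N ^ ε := by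
        rw [Real.exp_add, Real.rpow_def_of_pos hN, mul_comm (Real.log N) ε]

/-- Degree lever ⟹ paired bound on the whole class, given the Fermat input on the class: the composition step of
`ManyPrimeValuationProduct_of` (rev c4). -/
theorem pairedFactorisationBound_of_degree (hFI : FermatInputOnClass) (hJ : JLDegreePackage)
    (hL : ShimuraDegreeLowerBound) : PairedFactorisationBound := by
  intro ε hε
  obtain ⟨C, hC⟩ := pairedBoundFermat_of_degree hJ hL ε hε
  exact ⟨C, fun W _ hss D hD => hC W hss (hFI W hss (four_le_card_multPrimes hD)) D hD⟩

/-- **Stub 3 (degree form) from the facts, radius version** (rev c4 bridge, by definitional unfolding of stub 8): five cited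
theorems + the route item `MazurKenkuRadius` give `JLDegreePackage` on the whole class. -/
theorem jlDegreePackage_of_facts_radius
    (hJL : Literature.NumberTheory.Automorphic.nonempty_shimuraParametrizationData)
    (h61 : PastenThm61bAwayFromTwo)
    (hopt : Literature.NumberTheory.Automorphic.exists_optimal_modularParametrizationData)
    (hManin : Literature.NumberTheory.Automorphic.PastenShimura2024_cor_10_2)
    (hPet : Literature.NumberTheory.Automorphic.murty_petersson_newform_upper_bound)
    (hR : Summit.ABC.ABC.Theses.RibetTakahashiSplit.MazurKenkuRadius) : JLDegreePackage :=
  fun ε hε => stub_jlDegreePackageOfRadius hJL h61 hopt hManin hPet hR ε hε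

/-- **`JLPackage` from five cited theorems and the radius** (rev c4; supersedes the seven-hypothesis `jlPackage_of_facts`
of rev c3 by dropping h6/h7 in favour of `MazurKenkuRadius`). -/
theorem jlPackage_of_facts_radius
    (hJL : Literature.NumberTheory.Automorphic.nonempty_shimuraParametrizationData)
    (h61 : PastenThm61bAwayFromTwo)
    (hopt : Literature.NumberTheory.Automorphic.exists_optimal_modularParametrizationData)
    (hManin : Literature.NumberTheory.Automorphic.PastenShimura2024_cor_10_2)
    (hPet : Literature.NumberTheory.Automorphic.murty_petersson_newform_upper_bound)
    (hR : Summit.ABC.ABC.Theses.RibetTakahashiSplit.MazurKenkuRadius) : JLPackage :=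
  jlPackage_of_degreePackage (jlDegreePackage_of_facts_radius hJL h61 hopt hManin hPet hR)

/-- **The lever from the paired crux, modulo cited theorems** (rev c4 bridge, by definitional unfolding of stub 9):
Thm 6.1 numerator + optimal quotient + GHL + radius + crux_D ⟹ `ShimuraDegreeLowerBound`.  With
`pairedFactorisationBound_of_degree` (and the Fermat input on the class) this kernel-certifies: modulo CITED theorems the
registered lever is EQUIVALENT to the paired crux — any non-circular proof must bound `δ_{D,M}·covol(Λ_E)` from below
WITHOUT passing through `T_D`. -/
theorem shimuraDegreeLowerBound_of_facts_of_paired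
    (h61n : Literature.NumberTheory.Automorphic.PastenShimura2024_thm_6_1)
    (hopt : Literature.NumberTheory.Automorphic.exists_optimal_modularParametrizationData)
    (hGHL : Literature.NumberTheory.EllipticCurves.ModularForms.murty_petersson_newform_lower_bound)
    (hR : Summit.ABC.ABC.Theses.RibetTakahashiSplit.MazurKenkuRadius)
    (hP : PairedFactorisationBound) : ShimuraDegreeLowerBound :=
  fun ε hε => stub_shimuraDegreeLowerBoundOfPaired h61n hopt hGHL hR hP ε hε

/-! ## The crux from the line -/

/-- **The crux from the line** — the ONLY theorem of this file concluding
`Summit.ABC.ABC.Theses.RibetTakahashiSplit.ManyPrimeValuationProduct`, BY NAME; no hypotheses; the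
four composing registered stubs of rev c4 are INVOKED and sorries live only in `stub_*`.
Chain: Fermat input (known ∪ residual, `fermatInputOnClass_of`) + degree package + degree lever ⟹
`PairedFactorisationBound` (`pairedFactorisationBound_of_degree`, proved) ⟹ the crux
(`coveringGlue`: three covering sets, proved). -/
theorem ManyPrimeValuationProduct_of : ManyPrimeValuationProduct :=
  coveringGlue (pairedFactorisationBound_of_degree
    (fermatInputOnClass_of stub_fermatInputKnown stub_fermatInputResidual)
    stub_jlDegreePackage stub_shimuraDegreeLowerBound)

/-- The rev-a3 composition through the zero-cycle height, with the height as a HYPOTHESIS (the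
line's mechanism documented, kernel-checked): `ZeroCycleHeight` + the three arithmetic/package
stubs ⟹ `PairedFactorisationBound` (whence the crux by `coveringGlue`; stated one step short of the
crux so that `ManyPrimeValuationProduct_of` stays the file's only crux-concluding theorem). -/
theorem pairedFactorisationBound_of_zeroCycleHeight_stubs (hZ : ZeroCycleHeight) :
    PairedFactorisationBound :=
  pairedFactorisationBound_of
    (fermatInputOnClass_of stub_fermatInputKnown stub_fermatInputResidual) stub_jlPackage hZ

/-- **The θ-ladder, kernel-checked, and the reach of the line without stub 2's open part.** The
package, Jensen and the `θ`-weakened zero-cycle height give `T_D ≤ C N^{θ+ε}` for every covering set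
of every curve semistable away from `2` that satisfies the Fermat input — in particular (Pasten
L.6.11/L.6.12) for all semistable and all Frey–Hellegouarch curves, which is everything
`RibetTakahashiSplit.Assembly` feeds into the crux. At `θ = 0` this is the engine of
`pairedFactorisationBound_of`. -/
theorem pairedBoundTheta_of (θ : ℝ) (hJL : JLPackage) (hZ : ZeroCycleHeightTheta θ) :
    ∀ ε : ℝ, 0 < ε → ∃ C : ℝ, ∀ (W : WeierstrassCurve ℚ) [W.IsElliptic],
      IsSemistableAwayFromTwo W → FermatInput W → ∀ D : Finset ℕ, IsCoveringSet W D →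
        (valProd W D : ℝ) ≤ C * (W.conductorNorm ℤ : ℝ) ^ (θ + ε) := by
  intro ε hε
  have hε2 : 0 < ε / 2 := half_pos hε
  obtain ⟨C₁, hC₁⟩ := hJL (ε / 2) hε2
  obtain ⟨C₂, hC₂⟩ := hZ (ε / 2) hε2
  refine ⟨Real.exp (C₁ + C₂), fun W _ hss hF D hD => ?_⟩
  obtain ⟨L, S, F, s, hL, hFD, hF0, hFt, hs0, hper, hint₁, hint₂, hpos, hIpos, hineq⟩ :=
    hC₁ W hss hF D hD
  have hz := hC₂ W hss D hD L hL S F hFD hF0 hFt s hs0 hper hint₂ hint₁ hpos hIpos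
  have hJ := jensen_log hF0 hFt hint₁ hint₂ hpos hIpos
  set N : ℝ := (W.conductorNorm ℤ : ℝ) with hNdef
  set V : ℝ := (volume F).toReal with hVdef
  set I : ℝ := ∫ z in F, pet s z with hIdef
  have hV : 0 < V := ENNReal.toReal_pos hF0 hFt
  have hlogVI : Real.log (V⁻¹ * I) = Real.log I - Real.log V := by
    rw [Real.log_mul (inv_ne_zero hV.ne') hIpos.ne', Real.log_inv]; ring
  rw [hlogVI] at hJ
  have hlogT : Real.log (valProd W D) ≤ C₁ + C₂ + (θ + ε) * Real.log N := by linarith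
  have hN0 : 0 < W.conductorNorm ℤ := W.conductorNorm_pos_holds
  have hN : 0 < N := by rw [hNdef]; exact_mod_cast hN0
  have hT : (valProd W D : ℝ) ≤ Real.exp (Real.log (valProd W D)) := by
    rcases Nat.eq_zero_or_pos (valProd W D) with h | h
    · rw [h]; simp
    · rw [Real.exp_log (by exact_mod_cast h)]
  calc (valProd W D : ℝ) ≤ Real.exp (Real.log (valProd W D)) := hT
    _ ≤ Real.exp (C₁ + C₂ + (θ + ε) * Real.log N) := Real.exp_le_exp.mpr hlogT
    _ = Real.exp (C₁ + C₂) * N ^ (θ + ε) := by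
        rw [Real.exp_add, Real.rpow_def_of_pos hN, mul_comm (Real.log N) (θ + ε)]

/-! ## Rev a2/c1: stub 1 closed modulo named facts; the Frey-class and semistable-Frey re-cuts
(stmt-ABC-15149 / stmt-ABC-15174) from the line without stub 2 and without Mestre–Oesterlé -/

/-- **Stub 1 modulo named facts (PROVED).** `FermatInputKnown` from (A) the in-tree named fact
`mestreOesterle1989_thm_1` (Mestre–Oesterlé 1989 Thm 1 ⊇ Pasten L.6.11's `ℓ`-th power exclusion for
semistable curves) and (B) the generalized-Fermat input of Pasten L.6.12, stated here as a
hypothesis in the exact form of the landed `fermatInputKnown_of_mestreOesterle` (p82851); (B) is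
itself `genFermat_two_power_trivial hFLT hR hDM` from Mathlib's `FermatLastTheorem` and the landed
named facts `ribet1997_twoPowerFermat`, `darmonMerel1997_denesEquation` (p88991; corollary p88992). -/
theorem fermatInputKnown_of_inputs'
    (hMO : Literature.NumberTheory.EllipticCurves.mestreOesterle1989_thm_1)
    (hFermat : ∀ ℓ : ℕ, ℓ.Prime → 11 ≤ ℓ → ∀ (x y z : ℤ) (m : ℕ), m < ℓ → IsCoprime x y →
      IsCoprime x z → IsCoprime y z → Odd x → Odd z → x ^ ℓ + 2 ^ m * y ^ ℓ + z ^ ℓ = 0 →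
      (x * y * z).natAbs ≤ 1) :
    FermatInputKnown := fun W _ _hss h4 hAB =>
  Summit.ABC.ABC.Theorems.ManyPrimeValuationProduct.fermatInputKnown_of_mestreOesterle hMO hFermat W
    h4 hAB

/-- **The Fermat input on the FREY CLASS from the single cited generalized-Fermat theorem** (rev c1,
no Mestre–Oesterlé): for `W` ℚ-isomorphic to a twisted Frey–Hellegouarch curve with `≥ 2`
multiplicative primes, `FermatInput W` follows from "`x^ℓ + 2^m y^ℓ + z^ℓ = 0 ⇒ |xyz| ≤ 1` for prime
`ℓ ≥ 11`" (Cohen GTM 240 Thm 15.3.1 = Wiles + Ribet 1997 + Darmon–Merel 1997 = Pasten L.6.12's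
inputs), by the landed `exists_not_dvd_factorization_of_smul_eq_freyCurve` (p82851). -/
theorem fermatInput_of_isFreyIsomorphic
    (hFermat : ∀ ℓ : ℕ, ℓ.Prime → 11 ≤ ℓ → ∀ (x y z : ℤ) (m : ℕ), m < ℓ → IsCoprime x y →
      IsCoprime x z → IsCoprime y z → Odd x → Odd z → x ^ ℓ + 2 ^ m * y ^ ℓ + z ^ ℓ = 0 →
      (x * y * z).natAbs ≤ 1)
    (W : WeierstrassCurve ℚ) [W.IsElliptic] (hFrey : IsFreyIsomorphic W)
    (h2 : 2 ≤ (multPrimes W).card) : FermatInput W := by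
  intro ℓ hℓ h11
  obtain ⟨a, b, d, C, hab, h0, hd, hC⟩ := hFrey
  exact Summit.ABC.ABC.Theorems.ManyPrimeValuationProduct.exists_not_dvd_factorization_of_smul_eq_freyCurve
    hℓ (by omega) (hFermat ℓ hℓ h11) W hab h0 hd hC h2

/-- **Covering glue with the Fermat input as a per-curve hypothesis** (PROVED; same three covering
sets as `coveringGlue`): a per-covering-set bound valid for curves satisfying `FermatInput` gives
`T ≤ (max C 1)³ N^ε` for every such curve with `≥ 4` multiplicative primes. -/
theorem valProd_le_of_pairedBound_fermatInput
    (hP : ∀ ε : ℝ, 0 < ε → ∃ C : ℝ, ∀ (W : WeierstrassCurve ℚ) [W.IsElliptic],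
      IsSemistableAwayFromTwo W → FermatInput W → ∀ D : Finset ℕ, IsCoveringSet W D →
        (valProd W D : ℝ) ≤ C * (W.conductorNorm ℤ : ℝ) ^ ε) :
    ∀ ε : ℝ, 0 < ε → ∃ C : ℝ, ∀ (W : WeierstrassCurve ℚ) [W.IsElliptic],
      IsSemistableAwayFromTwo W → FermatInput W → 4 ≤ (multPrimes W).card →
        (valProd W (multPrimes W) : ℝ) ≤ C * (W.conductorNorm ℤ : ℝ) ^ ε := by
  intro ε hε
  obtain ⟨C, hC⟩ := hP (ε / 3) (by positivity)
  refine ⟨(max C 1) ^ 3, fun W _ hss hF hS4 => ?_⟩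
  obtain ⟨D₁, D₂, D₃, hD₁, hD₂, hD₃, hprod⟩ := exists_three_coveringSets (W := W) hS4
  have hN0' : 0 < W.conductorNorm ℤ := W.conductorNorm_pos_holds
  set N : ℝ := (W.conductorNorm ℤ : ℝ) with hNdef
  have hN0 : 0 < N := by rw [hNdef]; exact_mod_cast hN0'
  have hb : ∀ D, IsCoveringSet W D → (valProd W D : ℝ) ≤ max C 1 * N ^ (ε / 3) := fun D hD =>
    (hC W hss hF D hD).trans
      (mul_le_mul_of_nonneg_right (le_max_left _ _) (Real.rpow_nonneg hN0.le _))
  have hpow : (N ^ (ε / 3)) ^ (3 : ℕ) = N ^ ε := by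
    rw [← Real.rpow_natCast, ← Real.rpow_mul hN0.le]; norm_num
  calc (valProd W (multPrimes W) : ℝ) ≤ (valProd W D₁ : ℝ) * valProd W D₂ * valProd W D₃ := by
        exact_mod_cast hprod
    _ ≤ (max C 1 * N ^ (ε / 3)) * (max C 1 * N ^ (ε / 3)) * (max C 1 * N ^ (ε / 3)) := by
        gcongr
        · exact hb D₁ hD₁
        · exact hb D₂ hD₂
        · exact hb D₃ hD₃
    _ = (max C 1) ^ 3 * (N ^ (ε / 3)) ^ (3 : ℕ) := by ring
    _ = (max C 1) ^ 3 * N ^ ε := by rw [hpow]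

/-- **The Frey-class re-cut r2F from the line, WITHOUT stubs 1–2 and WITHOUT Mestre–Oesterlé**
(rev c1; concludes the route decl `RibetTakahashiSplit.ManyPrimeValuationProductFrey`, stmt-ABC-15149,
BY NAME): degree package (`stub_jlDegreePackage`) + degree lever (`stub_shimuraDegreeLowerBound`) + the single cited
generalized-Fermat input `hFermat` give `T(E) ≤ C_ε N^ε` for every `E` semistable away from `2`,
ℚ-isomorphic to a twisted Frey–Hellegouarch curve, with `≥ 4` odd multiplicative primes.  Chain:
`pairedBoundFermat_of_degree` ⟹ `valProd_le_of_pairedBound_fermatInput` ⟹ restrict to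
Frey-isomorphic curves, where `fermatInput_of_isFreyIsomorphic` supplies the Fermat input. -/
theorem manyPrimeFrey_of
    (hFermat : ∀ ℓ : ℕ, ℓ.Prime → 11 ≤ ℓ → ∀ (x y z : ℤ) (m : ℕ), m < ℓ → IsCoprime x y →
      IsCoprime x z → IsCoprime y z → Odd x → Odd z → x ^ ℓ + 2 ^ m * y ^ ℓ + z ^ ℓ = 0 →
      (x * y * z).natAbs ≤ 1) :
    Summit.ABC.ABC.Theses.RibetTakahashiSplit.ManyPrimeValuationProductFrey := by
  have hP := pairedBoundFermat_of_degree stub_jlDegreePackage stub_shimuraDegreeLowerBound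
  intro ε hε
  obtain ⟨C, hC⟩ := valProd_le_of_pairedBound_fermatInput hP ε hε
  refine ⟨C, fun W _ hss hFrey h4 => ?_⟩
  have hS4 : 4 ≤ (multPrimes W).card := by
    refine le_trans h4 (Finset.card_le_card fun p hp => ?_)
    simp only [multPrimes, Finset.mem_filter] at hp ⊢
    exact ⟨hp.1, hp.2.2⟩
  have hF : FermatInput W := fermatInput_of_isFreyIsomorphic hFermat W hFrey (by omega)
  exact hC W hss hF hS4

/-- **The semistable-Frey re-cut R2 from the line** (rev c1; concludes the route's STAFFED crux
`RibetTakahashiSplit.ManyPrimeValuationProductSemistableFrey`, stmt-ABC-15174, BY NAME): a semistable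
curve is semistable away from `2`, so this is `manyPrimeFrey_of` restricted. -/
theorem manyPrimeSemistableFrey_of
    (hFermat : ∀ ℓ : ℕ, ℓ.Prime → 11 ≤ ℓ → ∀ (x y z : ℤ) (m : ℕ), m < ℓ → IsCoprime x y →
      IsCoprime x z → IsCoprime y z → Odd x → Odd z → x ^ ℓ + 2 ^ m * y ^ ℓ + z ^ ℓ = 0 →
      (x * y * z).natAbs ≤ 1) :
    Summit.ABC.ABC.Theses.RibetTakahashiSplit.ManyPrimeValuationProductSemistableFrey := by
  intro ε hε
  obtain ⟨C, hC⟩ := manyPrimeFrey_of hFermat ε hε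
  exact ⟨C, fun W _ hss hFrey h4 => hC W (fun p hp _ => hss p hp) hFrey h4⟩

/-- **The whole-class paired bound modulo CITED theorems plus the two open statements, all
explicit** (rev c1; the honest one-line summary of the line for the planner — the crux is one
`coveringGlue` step away): Mestre–Oesterlé Thm 1 (`hMO`, cited XL) and the generalized-Fermat theorem
(`hFermat`, cited XL) close stub 1; what remains is stub 2 (`FermatInputResidual`, OPEN Diophantine
statement on the residual class), stub 3 (`JLPackage`, known in print on the printed class,
formalisation debt) and stub 4 (`MeanSquareLowerBound`, OPEN, crux-sized). -/
theorem pairedFactorisationBound_of_inputs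
    (hMO : Literature.NumberTheory.EllipticCurves.mestreOesterle1989_thm_1)
    (hFermat : ∀ ℓ : ℕ, ℓ.Prime → 11 ≤ ℓ → ∀ (x y z : ℤ) (m : ℕ), m < ℓ → IsCoprime x y →
      IsCoprime x z → IsCoprime y z → Odd x → Odd z → x ^ ℓ + 2 ^ m * y ^ ℓ + z ^ ℓ = 0 →
      (x * y * z).natAbs ≤ 1)
    (hR : FermatInputResidual) (hJL : JLPackage) (hM : MeanSquareLowerBound) :
    PairedFactorisationBound :=
  pairedFactorisationBound_of_meanSquare
    (fermatInputOnClass_of (fermatInputKnown_of_inputs' hMO hFermat) hR) hJL hM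


/-- **The whole-class paired bound modulo CITED theorems + one ROUTE ITEM + the two OPEN statements, all explicit
(rev c4; supersedes `pairedFactorisationBound_of_facts`: h6/h7 replaced by `MazurKenkuRadius`, the lever in degree form).**
Cited: Mestre–Oesterlé Thm 1 (`hMO`) and the generalized-Fermat theorem of Pasten L.6.12 (`hFermat`) — closing stub 1;
Jacquet–Langlands existence, Thm 6.1 (b′), optimal quotient, Cor 10.2, `‖f‖² ≪ N log N` — closing stub 3 with the route
item `MazurKenkuRadius` (stmt-ABC-15193, `hR`).  OPEN: stub 2 (`FermatInputResidual`) and stub 4 (`ShimuraDegreeLowerBound`,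
the lever, crux_D-equivalent modulo cited theorems by stubs 8/9).  The crux is one `coveringGlue` step away. -/
theorem pairedFactorisationBound_of_facts_radius
    (hMO : Literature.NumberTheory.EllipticCurves.mestreOesterle1989_thm_1)
    (hFermat : ∀ ℓ : ℕ, ℓ.Prime → 11 ≤ ℓ → ∀ (x y z : ℤ) (m : ℕ), m < ℓ → IsCoprime x y →
      IsCoprime x z → IsCoprime y z → Odd x → Odd z → x ^ ℓ + 2 ^ m * y ^ ℓ + z ^ ℓ = 0 →
      (x * y * z).natAbs ≤ 1)
    (hJL : Literature.NumberTheory.Automorphic.nonempty_shimuraParametrizationData)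
    (h61 : PastenThm61bAwayFromTwo)
    (hopt : Literature.NumberTheory.Automorphic.exists_optimal_modularParametrizationData)
    (hManin : Literature.NumberTheory.Automorphic.PastenShimura2024_cor_10_2)
    (hPet : Literature.NumberTheory.Automorphic.murty_petersson_newform_upper_bound)
    (hR : Summit.ABC.ABC.Theses.RibetTakahashiSplit.MazurKenkuRadius)
    (hRes : FermatInputResidual) (hL : ShimuraDegreeLowerBound) : PairedFactorisationBound :=
  pairedFactorisationBound_of_degree
    (fermatInputOnClass_of (fermatInputKnown_of_inputs' hMO hFermat) hRes)
    (jlDegreePackage_of_facts_radius hJL h61 hopt hManin hPet hR) hL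

end Summit.ABC.ABC.Cruxes.ManyPrimeValuationProduct.JlZeroCycleHeight


end
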